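import Literature.Computability.FineGrained.EditDistOVBits
import Literature.Computability.FineGrained.EditDistOVBlocks
import Literature.Computability.FineGrained.LCSFromOVProgram
import HarnessLib

/-!
# OV → binary edit distance on the word RAM, II: the reduction program — geometry, constants, set-up

The word-RAM oracle program behind the reduction "Orthogonal Vectors → binary edit distance" of
Bringmann–Künnemann (FOCS 2015, Thm. 3.3 with §5.2: the alignment gadget of Lemmas 5.3–5.4 and the
coordinate values of Lemma 5.2; Thm. 1.2 for Levenshtein distance; Backurs–Indyk, STOC 2015,
Thm. 1 for the architecture): on the encoding of an OV instance `I = (n, d, A, B)` it writes the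
edit-distance instance `(ovX I, ovY I)` of
`Literature.Computability.FineGrained.EditDistanceOVGadgets` (`BKReduction.ovX/ovY`) in the format
`encodeBoolPair`, asks the edit-distance oracle once, and compares the answer with the threshold
`BKReduction.ovThreshold I` (`BKReduction.editDist_ovX_ovY_le_iff`). This file is the twin of
`Literature.Computability.FineGrained.LCSFromOVProgram` (same register conventions, same innermost
coordinate-bit code `LCSRed.innerX1/innerY1`, which is reused verbatim) for the edit-distance
alignment gadget `G(z) = (1^{γ₁} 0^{γ₁})² z (0^{γ₁} 1^{γ₁})²`, blocks separated by `0^{γ₂}`, `y` padded by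
`0^{nγ₃}` (dispatch `EDRed.edWay` of `…EditDistOVBlocks`). It fixes

* the **geometry** `EDRed.Geo` (`n, d` and the relocation base `D = |input| + 100`) with all
  derived quantities (the level-2/3 gadget parameters `BKReduction.P₂ d`, `P₃ d`, the lengths
  `LX = |ovX I|`, `LY = |ovY I|`, the query address `Q`, the threshold `rho`, …) in the arithmetic
  form in which the program computes them, and the **constant registers** `EDRed.Geo.KR`
  (`EDRed.Geo.Consts R`: register file `R` holds them);
* the **set-up code** `EDRed.setup₁`, `EDRed.setupMain` (straight-line) and its certificates.

Register map: `0 = D + 1`, `1 = D` (left by `SProg.relocate`); `10 = n`, `11 = d`,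
`13 = D + 3` (address of `A₀₀`), `14 = n d`, `15 = D + 3 + n d` (address of `B₀₀`);
`16–19 = ℓₓ', ℓ_y', sₓ', γ₂'` (level 2); `30–35` level-1 values `200, 400, 800, 805, 1605` and period
`4015`, `36–37` the level-1 padding boundaries of `VG(b)`; `40–45` level-2 values and period
(`x` side), `46–47` level-2 boundaries (`y` side), `48–49` the padding boundaries of `NVG(b)`;
`50–55` level 3 (`x` side), `56–58` level 3 (`y` side), `59 = γ₂''`, `60 = 2nγ₃''`,
`61 = 60 + |core y|`, `62–65 = ℓₓ'', ℓ_y'', sₓ'', γ₃''`; `70 = LX`, `71 = LY`, `72 = Q`,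
`73 = 1 + LX + LY`, `74 = Q + 73`, `75 = Q + 1`, `76 = Q + 1 + LX`; `80 = ρ` (threshold);
volatile: `2–9`, `20–29` (`LCSRed.Kept`).
-/

namespace Literature.Computability.FineGrained.EDRed

open Cryptography Cryptography.WordRAM Cryptography.WordRAM.SProg BKGadget BKReduction LCSRed

/-! ### Geometry -/

/-- The geometry of a run: `n` vectors per list, dimension `d`, relocation base `D`. [folklore] -/
structure Geo where
  /-- Number of vectors per list. -/
  n : ℕ
  /-- Dimension. -/
  d : ℕ
  /-- Relocation base `|input| + 100`. -/
  D : ℕ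

namespace Geo

variable (g : Geo)

/-- Level-2 parameters (BK15 §3.1, types `t_x', t_y'`). [folklore] -/
def q₂ : BKGadget.Params := P₂ g.d
/-- Level-3 parameters (BK15 §3.1, types `t_x'', t_y''`). [folklore] -/
def q₃ : BKGadget.Params := P₃ g.d
/-- `4γ₁'` as computed (`γ₁' + γ₁' + (γ₁' + γ₁')`). [folklore] -/
def F₂ : ℕ := g.q₂.γ₁ + g.q₂.γ₁ + (g.q₂.γ₁ + g.q₂.γ₁)
/-- `|G'(z)| = 8γ₁' + ℓₓ'` at level 2, `x` side, as computed. [folklore] -/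
def G₂x : ℕ := g.F₂ + g.q₂.ℓx + g.F₂
/-- `|G'(VG b)| = 8γ₁' + ℓ_y'` at level 2, `y` side, as computed. [folklore] -/
def G₂y : ℕ := g.F₂ + g.q₂.ℓy + g.F₂
/-- The level-2 period `|G'(z) 0^{γ₂'}|`. [folklore] -/
def per₂ : ℕ := g.G₂x + g.q₂.γ₂
/-- The padding `2γ₃' = 4γ₂'` of `NVG(b)`, as computed. [folklore] -/
def pad₂ : ℕ := g.q₂.γ₂ * 4
/-- The padding `(d+1)γ₃` of `VG(b)` (level 1, `γ₃ = 4820`), as computed. [folklore] -/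
def pad₁ : ℕ := g.d * 4820 + 4820
/-- `4γ₁''` as computed. [folklore] -/
def F₃ : ℕ := g.q₃.γ₁ + g.q₃.γ₁ + (g.q₃.γ₁ + g.q₃.γ₁)
/-- `|G''(·)| = 8γ₁'' + ℓₓ''` at level 3, `x` side. [folklore] -/
def G₃ : ℕ := g.F₃ + g.q₃.ℓx + g.F₃
/-- `|G''(·)| = 8γ₁'' + ℓ_y''` at level 3, `y` side. [folklore] -/
def G₃y : ℕ := g.F₃ + g.q₃.ℓy + g.F₃
/-- The level-3 period, `x` side. [folklore] -/
def per₃ : ℕ := g.G₃ + g.q₃.γ₂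
/-- The level-3 period, `y` side. [folklore] -/
def per₃y : ℕ := g.G₃y + g.q₃.γ₂
/-- `|ovX I| = 2n |G''| + (2n - 1) γ₂''` (as computed by the program). [folklore] -/
def LX : ℕ := (g.n + g.n) * g.G₃ + (g.n + g.n - 1) * g.q₃.γ₂
/-- The core of `ovY I`: `n |G''_y| + (n - 1) γ₂''`. [folklore] -/
def LC : ℕ := g.n * g.G₃y + (g.n - 1) * g.q₃.γ₂
/-- The padding of `ovY I`: `2n γ₃''`. [folklore] -/
def NP : ℕ := (g.n + g.n) * g.q₃.γ₃
/-- `|ovY I| = 2 NP + LC`. [folklore] -/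
def LY : ℕ := g.NP + g.NP + g.LC
/-- The input length `2 + 2 n d` (the program reads it off `D = L + 100`). [folklore] -/
def L : ℕ := g.D - 100
/-- The query base (just above the relocated input). [folklore] -/
def Q : ℕ := g.D + g.L + 1
/-- The query length `1 + LX + LY`. [folklore] -/
def LEN : ℕ := g.LX + g.LY + 1
/-- `C₂ = C(2,1) = 8γ₂' - 4(4γ₁' + sₓ')` at level 2, as computed. [folklore] -/
def C₂ : ℕ := g.q₂.γ₂ * 8 - (g.F₂ + g.q₂.sx) * 4
/-- `C₁ = C(d+1, d+1) = 4(d+1)γ₂ = 9640(d+1)` at level 1, as computed. [folklore] -/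
def C₁ : ℕ := g.d * 9640 + 9640
/-- `ρ₀' = C₂ + (C₁ + (2d + 2))`. [folklore] -/
def rho₀ : ℕ := g.C₂ + (g.C₁ + (g.d + g.d + 2))
/-- `ρ₁' = C₂ + (C₁ + (2d + 4))`. [folklore] -/
def rho₁ : ℕ := g.C₂ + (g.C₁ + (g.d + g.d + 2 + 2))
/-- `C₃ = C(2n, n) = 8nγ₂'' - 4n(4γ₁'' + sₓ'')` at level 3, as computed. [folklore] -/
def C₃ : ℕ := g.n * g.q₃.γ₂ * 8 - (g.F₃ + g.q₃.sx) * g.n * 4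
/-- The threshold `ρ = C₃ + (n-1) ρ₁' + ρ₀'`. [folklore] -/
def rho : ℕ := g.C₃ + (g.n - 1) * g.rho₁ + g.rho₀

/-- **The constant registers** after the set-up. [folklore] -/
def KR : ℕ → ℕ
  | 0 => g.D + 1
  | 1 => g.D
  | 10 => g.n
  | 11 => g.d
  | 13 => g.D + 3
  | 14 => g.n * g.d
  | 15 => g.D + 3 + g.n * g.d
  | 16 => g.q₂.ℓx
  | 17 => g.q₂.ℓy
  | 18 => g.q₂.sx
  | 19 => g.q₂.γ₂
  | 30 => 200
  | 31 => 400
  | 32 => 800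
  | 33 => 805
  | 34 => 1605
  | 35 => 4015
  | 36 => g.pad₁
  | 37 => g.pad₁ + g.q₂.ℓx
  | 40 => g.q₂.γ₁
  | 41 => g.q₂.γ₁ + g.q₂.γ₁
  | 42 => g.F₂
  | 43 => g.F₂ + g.q₂.ℓx
  | 44 => g.G₂x
  | 45 => g.per₂
  | 46 => g.F₂ + g.q₂.ℓy
  | 47 => g.G₂y
  | 48 => g.pad₂
  | 49 => g.pad₂ + g.G₂y
  | 50 => g.q₃.γ₁
  | 51 => g.q₃.γ₁ + g.q₃.γ₁
  | 52 => g.F₃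
  | 53 => g.F₃ + g.q₃.ℓx
  | 54 => g.G₃
  | 55 => g.per₃
  | 56 => g.F₃ + g.q₃.ℓy
  | 57 => g.G₃y
  | 58 => g.per₃y
  | 59 => g.q₃.γ₂
  | 60 => g.NP
  | 61 => g.NP + g.LC
  | 62 => g.q₃.ℓx
  | 63 => g.q₃.ℓy
  | 64 => g.q₃.sx
  | 65 => g.q₃.γ₃
  | 70 => g.LX
  | 71 => g.LY
  | 72 => g.Q
  | 73 => g.LEN
  | 74 => g.Q + g.LEN
  | 75 => g.Q + 1
  | 76 => g.Q + 1 + g.LX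
  | 80 => g.rho
  | _ => 0

/-- The constant registers (everything the set-up leaves for the loops). [folklore] -/
def constRegs : List ℕ :=
  [0, 1, 10, 11, 13, 14, 15, 16, 17, 18, 19, 30, 31, 32, 33, 34, 35, 36, 37, 40, 41, 42, 43, 44, 45, 46,
    47, 48, 49, 50, 51, 52, 53, 54, 55, 56, 57, 58, 59, 60, 61, 62, 63, 64, 65, 70, 71, 72, 73, 74, 75,
    76, 80]

/-- `Consts R`: the register file `R` holds the constants. [folklore] -/
def Consts (R : ℕ → ℕ) : Prop := ∀ a ∈ constRegs, R a = g.KR a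

/-- No constant register is volatile (`2–9`, `20–29`). [folklore] -/
theorem not_mem_constRegs_of_volatile {a : ℕ} (ha : a ∈ [2, 3, 4, 5, 6, 7, 8, 9] ∨ (20 ≤ a ∧ a ≤ 29)) :
    a ∉ constRegs := by
  rcases ha with ha | ha
  · simp only [List.mem_cons, List.not_mem_nil, or_false] at ha
    rcases ha with rfl | rfl | rfl | rfl | rfl | rfl | rfl | rfl <;> decide
  · intro h; simp only [constRegs, List.mem_cons, List.not_mem_nil, or_false] at h; omega

/-- Constants survive code that keeps the registers outside a volatile list. [folklore] -/
theorem Consts.of_kept {g : Geo} {R R' : ℕ → ℕ} (h : g.Consts R) {S : List ℕ}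
    (hS : ∀ a ∈ S, a ∈ [2, 3, 4, 5, 6, 7, 8, 9] ∨ (20 ≤ a ∧ a ≤ 29)) (hK : Kept S R R') :
    g.Consts R' := fun a ha => by
  rw [hK a fun hs => not_mem_constRegs_of_volatile (hS a hs) ha]; exact h a ha

/-- A bound dominating every constant, address and intermediate value of the run: the sum of all
of them. [folklore] -/
def BND : ℕ :=
  10000 * (g.D + g.n + g.d + g.n * g.d + g.q₂.ℓx + g.q₂.ℓy + g.q₂.sx + g.q₂.γ₁ + g.q₂.γ₂ +
    g.q₃.ℓx + g.q₃.ℓy + g.q₃.sx + g.q₃.γ₁ + g.q₃.γ₂ + g.q₃.γ₃ + g.pad₁ + g.pad₂ + g.F₂ + g.F₃ +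
    g.G₂x + g.G₂y + g.G₃ + g.G₃y + g.per₂ + g.per₃ + g.per₃y + g.LX + g.LC + g.NP + g.LY + g.Q +
    g.LEN + g.n * g.q₃.γ₂ + (g.F₃ + g.q₃.sx) * g.n + g.C₂ + g.C₁ + g.rho₀ + g.rho₁ + g.C₃ + g.rho) +
    100000

/-- `Holds l R`: the registers listed in `l` hold their constants. [folklore] -/
def Holds (l : List ℕ) (R : ℕ → ℕ) : Prop := ∀ a ∈ l, R a = g.KR a

end Geo

/-! ### The set-up code -/

/-- Set-up, chunk 1: `n`, `d`, the addresses of `A` and `B`, the level-1 values and period.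
[folklore] -/
def setup₁ : List OpSpec :=
  [(.add, r 10, pt 0, im 0), (.add, r 12, r 0, im 1), (.add, r 11, pt 12, im 0),
   (.add, r 13, r 0, im 2), (.mul, r 14, r 10, r 11), (.add, r 15, r 13, r 14),
   (.add, r 30, im 200, im 0), (.add, r 31, im 400, im 0), (.add, r 32, im 800, im 0),
   (.add, r 33, im 805, im 0), (.add, r 34, im 1605, im 0), (.add, r 35, im 4015, im 0)]

/-- Set-up, chunk 2: the level-2 parameters (`16–19`), the level-1 padding boundaries (`36, 37`),
the level-2 values, boundaries and period (`40–49`). [folklore] -/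
def setup₂ : List OpSpec :=
  [(.mul, r 16, r 11, im 4015), (.add, r 16, r 16, im 1605),
   (.mul, r 36, r 11, im 4820), (.add, r 36, r 36, im 4820), (.add, r 37, r 36, r 16),
   (.add, r 17, r 36, r 36), (.add, r 17, r 17, r 16),
   (.mul, r 18, r 11, im 803), (.add, r 18, r 18, im 803),
   (.add, r 20, r 16, r 17), (.mul, r 40, r 20, im 20), (.add, r 41, r 40, r 40),
   (.add, r 42, r 41, r 41), (.add, r 43, r 42, r 16), (.add, r 44, r 43, r 42),
   (.mul, r 19, r 16, im 239), (.mul, r 21, r 17, im 240), (.add, r 19, r 19, r 21),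
   (.mul, r 21, r 18, im 5), (.add, r 19, r 19, r 21),
   (.add, r 45, r 44, r 19),
   (.add, r 46, r 42, r 17), (.add, r 47, r 46, r 42), (.mul, r 48, r 19, im 4),
   (.add, r 49, r 48, r 47)]

/-- Set-up, chunk 3: the level-3 parameters (`62–65`, `59`), values, boundaries and periods
(`50–58`). [folklore] -/
def setup₃ : List OpSpec :=
  [(.add, r 62, r 44, r 44), (.add, r 62, r 62, r 19),
   (.add, r 63, r 48, r 48), (.add, r 63, r 63, r 47),
   (.add, r 64, r 42, r 18), (.add, r 64, r 64, r 64),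
   (.add, r 20, r 62, r 63), (.mul, r 50, r 20, im 20), (.add, r 51, r 50, r 50),
   (.add, r 52, r 51, r 51), (.add, r 53, r 52, r 62), (.add, r 54, r 53, r 52),
   (.mul, r 59, r 62, im 239), (.mul, r 21, r 63, im 240), (.add, r 59, r 59, r 21),
   (.mul, r 21, r 64, im 5), (.add, r 59, r 59, r 21),
   (.add, r 65, r 59, r 59),
   (.add, r 55, r 54, r 59), (.add, r 56, r 52, r 63), (.add, r 57, r 56, r 52),
   (.add, r 58, r 57, r 59)]

/-- Set-up, chunk 4: lengths and addresses (`60, 61, 70–76`). [folklore] -/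
def setup₄ : List OpSpec :=
  [(.add, r 7, r 10, r 10), (.mul, r 60, r 7, r 65),
   (.mul, r 70, r 7, r 54), (.sub, r 8, r 7, im 1), (.mul, r 8, r 8, r 59), (.add, r 70, r 70, r 8),
   (.mul, r 9, r 10, r 57), (.sub, r 8, r 10, im 1), (.mul, r 8, r 8, r 59), (.add, r 9, r 9, r 8),
   (.add, r 61, r 60, r 9),
   (.add, r 71, r 60, r 60), (.add, r 71, r 71, r 9),
   (.sub, r 8, r 1, im 100),
   (.add, r 72, r 1, r 8), (.add, r 72, r 72, im 1),
   (.add, r 75, r 72, im 1), (.add, r 76, r 75, r 70),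
   (.add, r 73, r 70, r 71), (.add, r 73, r 73, im 1),
   (.add, r 74, r 72, r 73)]

/-- Set-up, chunk 5: the threshold (`80`), the header word `mem[Q] := LX`, and the initialisation
of the first loop (`3 = 0`, `4 = LX`). [folklore] -/
def setup₅ : List OpSpec :=
  [(.mul, r 20, r 19, im 8), (.add, r 21, r 42, r 18), (.mul, r 21, r 21, im 4),
   (.sub, r 20, r 20, r 21),
   (.mul, r 21, r 11, im 9640), (.add, r 21, r 21, im 9640),
   (.add, r 22, r 11, r 11), (.add, r 22, r 22, im 2),
   (.add, r 23, r 21, r 22), (.add, r 23, r 20, r 23),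
   (.add, r 24, r 22, im 2), (.add, r 24, r 21, r 24), (.add, r 24, r 20, r 24),
   (.mul, r 25, r 10, r 59), (.mul, r 25, r 25, im 8),
   (.add, r 26, r 52, r 64), (.mul, r 26, r 26, r 10), (.mul, r 26, r 26, im 4),
   (.sub, r 25, r 25, r 26),
   (.sub, r 27, r 10, im 1), (.mul, r 27, r 27, r 24),
   (.add, r 80, r 25, r 27), (.add, r 80, r 80, r 23),
   (.add, pt 72, r 70, im 0),
   (.add, r 3, im 0, im 0), (.add, r 4, r 70, im 0)]

section setup

variable {W : ℕ} {O : List ℕ → List ℕ} (g : Geo)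

-- Symbolic execution uses one uniform `simp only` read/write normaliser; not every lemma fires in
-- every block (lint debt shared with `LCSFromOVProgram`).
set_option linter.unusedSimpArgs false

/-- **Chunk 1 of the set-up.** From the relocated memory (`0 = D + 1`, `1 = D`; `n` at `D + 1`,
`d` at `D + 2`) it leaves the registers `0, 1, 10, 11, 13, 14, 15, 30–35` at their constants.
[folklore] -/
theorem setup₁_spec {R H : ℕ → ℕ} (h0 : R 0 = g.D + 1) (h1 : R 1 = g.D) (hD : 100 ≤ g.D)
    (hn : H (g.D + 1) = g.n) (hd : H (g.D + 2) = g.d) (hB : g.BND < 2 ^ W) :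
    Achieves W O (block setup₁) (merge R H)
      (fun m => ∃ R', m = merge R' H ∧ g.Holds [0, 1, 10, 11, 13, 14, 15, 30, 31, 32, 33, 34, 35] R')
      12 := by
  have hBND : 10000 * (g.D + g.n + g.d + g.n * g.d) + 100000 ≤ g.BND := by unfold Geo.BND; omega
  refine achieves_block_of_eq' (fun m' hm' => ?_) le_rfl
  simp (disch := first | omega | decide) only [setup₁, execOps_cons, execOps_nil, execOp,
    Operand.write, Operand.read, merge_apply_of_lt, merge_apply_of_le, update_merge_of_lt,
    update_merge_of_le, Function.update_self, Function.update_of_ne, BinOp.eval_add_of_lt,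
    BinOp.eval_sub_of_le, BinOp.eval_mul_of_lt, Nat.add_zero, Nat.zero_add, h0, h1, hn, hd] at hm'
  subst hm'
  refine ⟨_, rfl, fun a ha => ?_⟩
  simp only [List.mem_cons, List.not_mem_nil, or_false] at ha
  rcases ha with rfl | rfl | rfl | rfl | rfl | rfl | rfl | rfl | rfl | rfl | rfl | rfl | rfl <;>
    simp (disch := decide) only [Function.update_self, Function.update_of_ne, h0, h1] <;> rfl

namespace Geo

/-- The level-2 length `ℓₓ'` in numerals. [folklore] -/
theorem q₂_ℓx : g.q₂.ℓx = g.d * 4015 + 1605 := by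
  show (g.d + 1) * (8 * P₁.γ₁ + 5) + g.d * P₁.γ₂ = _
  rw [P₁_γ₁, P₁_γ₂]; ring

/-- The level-2 length `ℓ_y'` in numerals. [folklore] -/
theorem q₂_ℓy : g.q₂.ℓy = g.pad₁ + g.pad₁ + g.q₂.ℓx := by
  show 2 * ((g.d + 1) * P₁.γ₃) + ((g.d + 1) * (8 * P₁.γ₁ + 5) + g.d * P₁.γ₂) =
    (g.d * 4820 + 4820) + (g.d * 4820 + 4820) + ((g.d + 1) * (8 * P₁.γ₁ + 5) + g.d * P₁.γ₂)
  rw [P₁_γ₃]; ring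

/-- The level-2 number of ones `sₓ'` in numerals. [folklore] -/
theorem q₂_sx : g.q₂.sx = g.d * 803 + 803 := by
  show (g.d + 1) * (4 * P₁.γ₁ + 3) = _
  rw [P₁_γ₁]; ring

/-- [folklore] -/ theorem q₂_γ₁ : g.q₂.γ₁ = 20 * (g.q₂.ℓx + g.q₂.ℓy) := rfl
/-- [folklore] -/ theorem q₂_γ₂ : g.q₂.γ₂ = 239 * g.q₂.ℓx + 240 * g.q₂.ℓy + 5 * g.q₂.sx := rfl
/-- [folklore] -/ theorem q₂_γ₃ : g.q₂.γ₃ = 2 * g.q₂.γ₂ := rfl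
/-- [folklore] -/ theorem q₃_ℓx : g.q₃.ℓx = 2 * (8 * g.q₂.γ₁ + g.q₂.ℓx) + g.q₂.γ₂ := rfl
/-- [folklore] -/ theorem q₃_ℓy : g.q₃.ℓy = 2 * (2 * g.q₂.γ₃) + (8 * g.q₂.γ₁ + g.q₂.ℓy) := rfl
/-- [folklore] -/ theorem q₃_sx : g.q₃.sx = 2 * (4 * g.q₂.γ₁ + g.q₂.sx) := rfl
/-- [folklore] -/ theorem q₃_γ₁ : g.q₃.γ₁ = 20 * (g.q₃.ℓx + g.q₃.ℓy) := rfl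
/-- [folklore] -/ theorem q₃_γ₂ : g.q₃.γ₂ = 239 * g.q₃.ℓx + 240 * g.q₃.ℓy + 5 * g.q₃.sx := rfl
/-- [folklore] -/ theorem q₃_γ₃ : g.q₃.γ₃ = 2 * g.q₃.γ₂ := rfl

/-! Folding the set-up's arithmetic back into the named parameters (keeps symbolic execution
small). -/

/-- [folklore] -/ theorem fold_ℓx₂ : g.d * 4015 + 1605 = g.q₂.ℓx := g.q₂_ℓx.symm
/-- [folklore] -/ theorem fold_pad₁ : g.d * 4820 + 4820 = g.pad₁ := rfl
/-- [folklore] -/ theorem fold_ℓy₂ : g.pad₁ + g.pad₁ + g.q₂.ℓx = g.q₂.ℓy := g.q₂_ℓy.symm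
/-- [folklore] -/ theorem fold_sx₂ : g.d * 803 + 803 = g.q₂.sx := g.q₂_sx.symm
/-- [folklore] -/ theorem fold_γ₁₂ : (g.q₂.ℓx + g.q₂.ℓy) * 20 = g.q₂.γ₁ := by rw [q₂_γ₁]; ring
/-- [folklore] -/ theorem fold_F₂ : g.q₂.γ₁ + g.q₂.γ₁ + (g.q₂.γ₁ + g.q₂.γ₁) = g.F₂ := rfl
/-- [folklore] -/ theorem fold_G₂x : g.F₂ + g.q₂.ℓx + g.F₂ = g.G₂x := rfl
/-- [folklore] -/ theorem fold_γ₂₂ :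
    g.q₂.ℓx * 239 + g.q₂.ℓy * 240 + g.q₂.sx * 5 = g.q₂.γ₂ := by rw [q₂_γ₂]; ring
/-- [folklore] -/ theorem fold_per₂ : g.G₂x + g.q₂.γ₂ = g.per₂ := rfl
/-- [folklore] -/ theorem fold_G₂y : g.F₂ + g.q₂.ℓy + g.F₂ = g.G₂y := rfl
/-- [folklore] -/ theorem fold_pad₂ : g.q₂.γ₂ * 4 = g.pad₂ := rfl
/-- [folklore] -/ theorem fold_ℓx₃ : g.G₂x + g.G₂x + g.q₂.γ₂ = g.q₃.ℓx := by
  rw [q₃_ℓx]; unfold G₂x F₂; ring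
/-- [folklore] -/ theorem fold_ℓy₃ : g.pad₂ + g.pad₂ + g.G₂y = g.q₃.ℓy := by
  rw [q₃_ℓy, q₂_γ₃]; unfold G₂y F₂ pad₂; ring
/-- [folklore] -/ theorem fold_sx₃ : g.F₂ + g.q₂.sx + (g.F₂ + g.q₂.sx) = g.q₃.sx := by
  rw [q₃_sx]; unfold F₂; ring
/-- [folklore] -/ theorem fold_γ₁₃ : (g.q₃.ℓx + g.q₃.ℓy) * 20 = g.q₃.γ₁ := by rw [q₃_γ₁]; ring
/-- [folklore] -/ theorem fold_F₃ : g.q₃.γ₁ + g.q₃.γ₁ + (g.q₃.γ₁ + g.q₃.γ₁) = g.F₃ := rfl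
/-- [folklore] -/ theorem fold_G₃ : g.F₃ + g.q₃.ℓx + g.F₃ = g.G₃ := rfl
/-- [folklore] -/ theorem fold_γ₂₃ :
    g.q₃.ℓx * 239 + g.q₃.ℓy * 240 + g.q₃.sx * 5 = g.q₃.γ₂ := by rw [q₃_γ₂]; ring
/-- [folklore] -/ theorem fold_γ₃₃ : g.q₃.γ₂ + g.q₃.γ₂ = g.q₃.γ₃ := by rw [q₃_γ₃]; ring
/-- [folklore] -/ theorem fold_per₃ : g.G₃ + g.q₃.γ₂ = g.per₃ := rfl
/-- [folklore] -/ theorem fold_G₃y : g.F₃ + g.q₃.ℓy + g.F₃ = g.G₃y := rfl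
/-- [folklore] -/ theorem fold_per₃y : g.G₃y + g.q₃.γ₂ = g.per₃y := rfl

/-- Linear bounds for the level-2/3 parameters in terms of `d` (for the word-size side conditions
of the set-up). [folklore] -/
theorem params_le :
    g.q₂.ℓx ≤ 4015 * (g.d + 1) ∧ g.q₂.ℓy ≤ 13655 * (g.d + 1) ∧ g.q₂.sx ≤ 803 * (g.d + 1) ∧
    g.q₂.γ₁ ≤ 353400 * (g.d + 1) ∧ g.q₂.γ₂ ≤ 4240800 * (g.d + 1) ∧
    g.q₃.ℓx ≤ 9903230 * (g.d + 1) ∧ g.q₃.ℓy ≤ 36767255 * (g.d + 1) ∧ g.q₃.sx ≤ 2828806 * (g.d + 1) ∧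
    g.q₃.γ₁ ≤ 933409700 * (g.d + 1) ∧ g.q₃.γ₂ ≤ 11205157200 * (g.d + 1) := by
  have e1 := g.q₂_ℓx; have e2 := g.q₂_ℓy; have e3 := g.q₂_sx; have e4 := g.q₂_γ₁; have e5 := g.q₂_γ₂
  have e6 := g.q₃_ℓx; have e7 := g.q₃_ℓy; have e8 := g.q₃_sx; have e9 := g.q₃_γ₁; have e10 := g.q₃_γ₂
  have e11 := g.q₂_γ₃
  unfold pad₁ at e2
  omega

end Geo

set_option maxHeartbeats 1600000 in
/-- **Chunk 2 of the set-up.** [folklore] -/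
theorem setup₂_spec {R H : ℕ → ℕ} (hC : g.Holds [0, 1, 10, 11, 13, 14, 15, 30, 31, 32, 33, 34, 35] R)
    (hB : g.BND < 2 ^ W) :
    Achieves W O (block setup₂) (merge R H)
      (fun m => ∃ R', m = merge R' H ∧
        g.Holds [0, 1, 10, 11, 13, 14, 15, 30, 31, 32, 33, 34, 35, 16, 17, 18, 19, 36, 37, 40, 41, 42, 43,
          44, 45, 46, 47, 48, 49] R') 25 := by
  have hBND : 10000 * (g.d + g.q₂.ℓx + g.q₂.ℓy + g.q₂.sx + g.q₂.γ₁ + g.q₂.γ₂ + g.pad₁ + g.pad₂ +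
      g.F₂ + g.G₂x + g.G₂y + g.per₂) + 100000 ≤ g.BND := by
    unfold Geo.BND; omega
  have h11 : R 11 = g.d := hC 11 (by simp)
  refine achieves_block_of_eq' (fun m' hm' => ?_) (by decide)
  simp (disch := first | omega | decide) only [setup₂, execOps_cons, execOps_nil, execOp,
    Operand.write, Operand.read, merge_apply_of_lt, merge_apply_of_le, update_merge_of_lt,
    update_merge_of_le, Function.update_self, Function.update_of_ne, BinOp.eval_add_of_lt,
    BinOp.eval_sub_of_le, BinOp.eval_mul_of_lt, Nat.add_zero, Nat.zero_add, h11, g.fold_ℓx₂,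
    g.fold_pad₁, g.fold_ℓy₂, g.fold_sx₂, g.fold_γ₁₂, g.fold_F₂, g.fold_G₂x, g.fold_γ₂₂, g.fold_per₂,
    g.fold_G₂y, g.fold_pad₂] at hm'
  subst hm'
  refine ⟨_, rfl, fun a ha => ?_⟩
  simp only [List.mem_cons, List.not_mem_nil, or_false] at ha
  rcases ha with rfl | rfl | rfl | rfl | rfl | rfl | rfl | rfl | rfl | rfl | rfl | rfl | rfl | rfl |
    rfl | rfl | rfl | rfl | rfl | rfl | rfl | rfl | rfl | rfl | rfl | rfl | rfl | rfl | rfl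
  all_goals
    simp (disch := decide) only [Function.update_self, Function.update_of_ne]
    first
      | exact hC _ (by simp)
      | rfl

set_option maxHeartbeats 1600000 in
/-- **Chunk 3 of the set-up.** [folklore] -/
theorem setup₃_spec {R H : ℕ → ℕ}
    (hC : g.Holds [0, 1, 10, 11, 13, 14, 15, 30, 31, 32, 33, 34, 35, 16, 17, 18, 19, 36, 37, 40, 41, 42,
      43, 44, 45, 46, 47, 48, 49] R) (hB : g.BND < 2 ^ W) :
    Achieves W O (block setup₃) (merge R H)
      (fun m => ∃ R', m = merge R' H ∧
        g.Holds [0, 1, 10, 11, 13, 14, 15, 30, 31, 32, 33, 34, 35, 16, 17, 18, 19, 36, 37, 40, 41, 42, 43,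
          44, 45, 46, 47, 48, 49, 62, 63, 64, 50, 51, 52, 53, 54, 59, 65, 55, 56, 57, 58] R') 22 := by
  have hBND : 10000 * (g.q₂.ℓx + g.q₂.ℓy + g.q₂.sx + g.q₂.γ₁ + g.q₂.γ₂ + g.q₃.ℓx + g.q₃.ℓy + g.q₃.sx +
      g.q₃.γ₁ + g.q₃.γ₂ + g.q₃.γ₃ + g.pad₂ + g.F₂ + g.F₃ + g.G₂x + g.G₂y + g.G₃ + g.G₃y + g.per₃ +
      g.per₃y) + 100000 ≤ g.BND := by
    unfold Geo.BND; omega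
  have h44 : R 44 = g.G₂x := hC 44 (by simp)
  have h19 : R 19 = g.q₂.γ₂ := hC 19 (by simp)
  have h48 : R 48 = g.pad₂ := hC 48 (by simp)
  have h47 : R 47 = g.G₂y := hC 47 (by simp)
  have h42 : R 42 = g.F₂ := hC 42 (by simp)
  have h18 : R 18 = g.q₂.sx := hC 18 (by simp)
  refine achieves_block_of_eq' (fun m' hm' => ?_) (by decide)
  simp (disch := first | omega | decide) only [setup₃, execOps_cons, execOps_nil, execOp,
    Operand.write, Operand.read, merge_apply_of_lt, merge_apply_of_le, update_merge_of_lt,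
    update_merge_of_le, Function.update_self, Function.update_of_ne, BinOp.eval_add_of_lt,
    BinOp.eval_sub_of_le, BinOp.eval_mul_of_lt, Nat.add_zero, Nat.zero_add, h44, h19, h48, h47, h42,
    h18, g.fold_ℓx₃, g.fold_ℓy₃, g.fold_sx₃, g.fold_γ₁₃, g.fold_F₃, g.fold_G₃, g.fold_γ₂₃, g.fold_γ₃₃,
    g.fold_per₃, g.fold_G₃y, g.fold_per₃y] at hm'
  subst hm'
  refine ⟨_, rfl, fun a ha => ?_⟩
  simp only [List.mem_cons, List.not_mem_nil, or_false] at ha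
  rcases ha with rfl | rfl | rfl | rfl | rfl | rfl | rfl | rfl | rfl | rfl | rfl | rfl | rfl | rfl |
    rfl | rfl | rfl | rfl | rfl | rfl | rfl | rfl | rfl | rfl | rfl | rfl | rfl | rfl | rfl | rfl | rfl |
    rfl | rfl | rfl | rfl | rfl | rfl | rfl | rfl | rfl | rfl | rfl | rfl
  all_goals
    simp (disch := decide) only [Function.update_self, Function.update_of_ne]
    first
      | exact hC _ (by simp)
      | rfl

set_option maxHeartbeats 1600000 in
/-- **Chunk 4 of the set-up.** [folklore] -/
theorem setup₄_spec {R H : ℕ → ℕ}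
    (hC : g.Holds [0, 1, 10, 11, 13, 14, 15, 30, 31, 32, 33, 34, 35, 16, 17, 18, 19, 36, 37, 40, 41, 42,
      43, 44, 45, 46, 47, 48, 49, 62, 63, 64, 50, 51, 52, 53, 54, 59, 65, 55, 56, 57, 58] R)
    (hD : 100 ≤ g.D) (hn : 1 ≤ g.n) (hB : g.BND < 2 ^ W) :
    Achieves W O (block setup₄) (merge R H)
      (fun m => ∃ R', m = merge R' H ∧
        g.Holds [0, 1, 10, 11, 13, 14, 15, 30, 31, 32, 33, 34, 35, 16, 17, 18, 19, 36, 37, 40, 41, 42, 43,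
          44, 45, 46, 47, 48, 49, 62, 63, 64, 50, 51, 52, 53, 54, 59, 65, 55, 56, 57, 58, 60, 61, 70, 71,
          72, 73, 74, 75, 76] R') 21 := by
  have hBND : 10000 * (g.D + g.n + g.q₃.γ₂ + g.q₃.γ₃ + g.G₃ + g.G₃y + g.LX + g.LC + g.NP + g.LY +
      g.Q + g.LEN) + 100000 ≤ g.BND := by
    unfold Geo.BND; omega
  have hLX : g.LX = (g.n + g.n) * g.G₃ + (g.n + g.n - 1) * g.q₃.γ₂ := rfl
  have hLC : g.LC = g.n * g.G₃y + (g.n - 1) * g.q₃.γ₂ := rfl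
  have hNP : g.NP = (g.n + g.n) * g.q₃.γ₃ := rfl
  have hLY : g.LY = g.NP + g.NP + g.LC := rfl
  have hQ : g.Q = g.D + (g.D - 100) + 1 := rfl
  have hLEN : g.LEN = g.LX + g.LY + 1 := rfl
  have h10 : R 10 = g.n := hC 10 (by simp)
  have h65 : R 65 = g.q₃.γ₃ := hC 65 (by simp)
  have h54 : R 54 = g.G₃ := hC 54 (by simp)
  have h57 : R 57 = g.G₃y := hC 57 (by simp)
  have h59 : R 59 = g.q₃.γ₂ := hC 59 (by simp)
  have h1 : R 1 = g.D := hC 1 (by simp)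
  refine achieves_block_of_eq' (fun m' hm' => ?_) (by decide)
  simp (disch := first | omega | decide) only [setup₄, execOps_cons, execOps_nil, execOp,
    Operand.write, Operand.read, merge_apply_of_lt, merge_apply_of_le, update_merge_of_lt,
    update_merge_of_le, Function.update_self, Function.update_of_ne, BinOp.eval_add_of_lt,
    BinOp.eval_sub_of_le, BinOp.eval_mul_of_lt, Nat.add_zero, Nat.zero_add, h10, h65, h54, h57, h59,
    h1, ← hNP, ← hLX, ← hLC, ← hLY, ← hQ, ← hLEN] at hm'
  subst hm'
  refine ⟨_, rfl, fun a ha => ?_⟩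
  simp only [List.mem_cons, List.not_mem_nil, or_false] at ha
  rcases ha with rfl | rfl | rfl | rfl | rfl | rfl | rfl | rfl | rfl | rfl | rfl | rfl | rfl | rfl |
    rfl | rfl | rfl | rfl | rfl | rfl | rfl | rfl | rfl | rfl | rfl | rfl | rfl | rfl | rfl | rfl | rfl |
    rfl | rfl | rfl | rfl | rfl | rfl | rfl | rfl | rfl | rfl | rfl | rfl | rfl | rfl | rfl | rfl | rfl |
    rfl | rfl | rfl | rfl
  all_goals
    simp (disch := decide) only [Function.update_self, Function.update_of_ne]
    first
      | exact hC _ (by simp)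
      | rfl

/-- `4(4γ₁ + sₓ) ≤ 8γ₂` at levels 2 and 3 (no underflow in `C₂`, `C₃`). [folklore] -/
theorem Geo.C_sub_le : (g.F₂ + g.q₂.sx) * 4 ≤ g.q₂.γ₂ * 8 ∧ (g.F₃ + g.q₃.sx) * g.n * 4 ≤ g.n * g.q₃.γ₂ * 8 := by
  have e4 := g.q₂_γ₁; have e5 := g.q₂_γ₂; have f4 := g.q₃_γ₁; have f5 := g.q₃_γ₂
  have h2 : g.F₂ + g.q₂.sx ≤ g.q₂.γ₂ := by unfold Geo.F₂; omega
  have h3 : g.F₃ + g.q₃.sx ≤ g.q₃.γ₂ := by unfold Geo.F₃; omega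
  refine ⟨by omega, ?_⟩
  calc (g.F₃ + g.q₃.sx) * g.n * 4 ≤ g.q₃.γ₂ * g.n * 4 :=
        Nat.mul_le_mul_right _ (Nat.mul_le_mul_right _ h3)
    _ ≤ g.n * g.q₃.γ₂ * 8 := by rw [Nat.mul_comm g.q₃.γ₂ g.n]; omega

set_option maxHeartbeats 1600000 in
/-- **Chunk 5 of the set-up**: the threshold, the header word, the loop initialisation. [folklore] -/
theorem setup₅_spec {R H : ℕ → ℕ}
    (hC : g.Holds [0, 1, 10, 11, 13, 14, 15, 30, 31, 32, 33, 34, 35, 16, 17, 18, 19, 36, 37, 40, 41, 42,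
      43, 44, 45, 46, 47, 48, 49, 62, 63, 64, 50, 51, 52, 53, 54, 59, 65, 55, 56, 57, 58, 60, 61, 70, 71,
      72, 73, 74, 75, 76] R) (hD : 100 ≤ g.D) (hn : 1 ≤ g.n) (hB : g.BND < 2 ^ W) :
    Achieves W O (block setup₅) (merge R H)
      (fun m => ∃ R', m = merge R' (Function.update H g.Q g.LX) ∧ g.Consts R' ∧ R' 3 = 0 ∧
        R' 4 = g.LX) 26 := by
  have hBND : 10000 * (g.D + g.n + g.d + g.q₂.sx + g.q₂.γ₂ + g.q₃.sx + g.q₃.γ₂ + g.F₂ + g.F₃ + g.LX +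
      g.Q + g.n * g.q₃.γ₂ + (g.F₃ + g.q₃.sx) * g.n + g.C₂ + g.C₁ + g.rho₀ + g.rho₁ + g.C₃ + g.rho) +
      100000 ≤ g.BND := by
    unfold Geo.BND; omega
  have hC₂ : g.q₂.γ₂ * 8 - (g.F₂ + g.q₂.sx) * 4 = g.C₂ := rfl
  have hC₁ : g.d * 9640 + 9640 = g.C₁ := rfl
  have hρ₀ : g.C₂ + (g.C₁ + (g.d + g.d + 2)) = g.rho₀ := rfl
  have hρ₁ : g.C₂ + (g.C₁ + (g.d + g.d + 2 + 2)) = g.rho₁ := rfl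
  have hC₃ : g.n * g.q₃.γ₂ * 8 - (g.F₃ + g.q₃.sx) * g.n * 4 = g.C₃ := rfl
  have hρ : g.C₃ + (g.n - 1) * g.rho₁ + g.rho₀ = g.rho := rfl
  obtain ⟨bC₂, bC₃⟩ := g.C_sub_le
  have bρ : (g.n - 1) * g.rho₁ ≤ g.rho := by unfold Geo.rho; omega
  have hQ : 100 ≤ g.Q := by unfold Geo.Q; omega
  have h19 : R 19 = g.q₂.γ₂ := hC 19 (by simp)
  have h42 : R 42 = g.F₂ := hC 42 (by simp)
  have h18 : R 18 = g.q₂.sx := hC 18 (by simp)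
  have h11 : R 11 = g.d := hC 11 (by simp)
  have h10 : R 10 = g.n := hC 10 (by simp)
  have h59 : R 59 = g.q₃.γ₂ := hC 59 (by simp)
  have h52 : R 52 = g.F₃ := hC 52 (by simp)
  have h64 : R 64 = g.q₃.sx := hC 64 (by simp)
  have h72 : R 72 = g.Q := hC 72 (by simp)
  have h70 : R 70 = g.LX := hC 70 (by simp)
  refine achieves_block_of_eq' (fun m' hm' => ?_) (by decide)
  simp (disch := first | omega | decide) only [setup₅, execOps_cons, execOps_nil, execOp,
    Operand.write, Operand.read, merge_apply_of_lt, merge_apply_of_le, update_merge_of_lt,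
    update_merge_of_le, Function.update_self, Function.update_of_ne, BinOp.eval_add_of_lt,
    BinOp.eval_sub_of_le, BinOp.eval_mul_of_lt, Nat.add_zero, Nat.zero_add, h19, h42, h18, h11, h10,
    h59, h52, h64, h72, h70, hC₂, hC₁, hρ₀, hρ₁, hC₃, hρ] at hm'
  subst hm'
  refine ⟨_, rfl, fun a ha => ?_, ?_, ?_⟩
  · simp only [Geo.constRegs, List.mem_cons, List.not_mem_nil, or_false] at ha
    rcases ha with rfl | rfl | rfl | rfl | rfl | rfl | rfl | rfl | rfl | rfl | rfl | rfl | rfl | rfl |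
      rfl | rfl | rfl | rfl | rfl | rfl | rfl | rfl | rfl | rfl | rfl | rfl | rfl | rfl | rfl | rfl |
      rfl | rfl | rfl | rfl | rfl | rfl | rfl | rfl | rfl | rfl | rfl | rfl | rfl | rfl | rfl | rfl |
      rfl | rfl | rfl | rfl | rfl | rfl | rfl
    all_goals
      simp (disch := decide) only [Function.update_self, Function.update_of_ne]
      first
        | exact hC _ (by simp)
        | rfl
  · simp (disch := decide) only [Function.update_self, Function.update_of_ne]
  · simp (disch := decide) only [Function.update_self, Function.update_of_ne]

/-- **The set-up of the main branch**: chunks 2–5. [folklore] -/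
def setupMain : SProg := seqs [block setup₂, block setup₃, block setup₄, block setup₅]

/-- `setupMain` is query-free. [folklore] -/
theorem setupMain_queryFree : setupMain.QueryFree :=
  seqs_queryFree fun s hs => by
    simp only [List.mem_cons, List.not_mem_nil, or_false] at hs
    rcases hs with rfl | rfl | rfl | rfl <;> exact block_queryFree _

/-- **Certificate of the set-up of the main branch.** From the registers left by chunk 1 it leaves
all constant registers at their values (`Geo.Consts`), the loop registers `3 = 0`, `4 = LX`, and the
header word `LX` at the query base `Q`, within `94` steps. [folklore] -/
theorem setupMain_spec {R H : ℕ → ℕ} (hC : g.Holds [0, 1, 10, 11, 13, 14, 15, 30, 31, 32, 33, 34, 35] R)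
    (hD : 100 ≤ g.D) (hn : 1 ≤ g.n) (hB : g.BND < 2 ^ W) :
    Achieves W O setupMain (merge R H)
      (fun m => ∃ R', m = merge R' (Function.update H g.Q g.LX) ∧ g.Consts R' ∧ R' 3 = 0 ∧
        R' 4 = g.LX) 94 := by
  unfold setupMain
  refine Achieves.seqs_cons (T₁ := 25) (T₂ := 69) (setup₂_spec g hC hB) fun m hm => ?_
  obtain ⟨R₂, hm, hC₂⟩ := hm
  subst hm
  refine Achieves.seqs_cons (T₁ := 22) (T₂ := 47) (setup₃_spec g hC₂ hB) fun m hm => ?_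
  obtain ⟨R₃, hm, hC₃⟩ := hm
  subst hm
  refine Achieves.seqs_cons (T₁ := 21) (T₂ := 26) (setup₄_spec g hC₃ hD hn hB) fun m hm => ?_
  obtain ⟨R₄, hm, hC₄⟩ := hm
  subst hm
  refine Achieves.seqs_cons (T₁ := 26) (T₂ := 0) (setup₅_spec g hC₄ hD hn hB) fun m hm => ?_
  exact Achieves.seqs_nil hm


end setup


/-! ### Writing `ovX I`: the loop body -/

section xloop

variable {W : ℕ} {O : List ℕ → List ℕ} (g : Geo) (I : OVInstance)

/-- `InputA H`: the data memory holds the bits of `A` at `D + 3 + i d + k`. [folklore] -/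
def InputA (H : ℕ → ℕ) : Prop :=
  ∀ (i : Fin I.n) (k : Fin I.d), H ((i : ℕ) * I.d + k + (g.D + 3)) = (I.A i k).toNat

/-- `InputB H`: the data memory holds the bits of `B` at `D + 3 + n d + j d + k`. [folklore] -/
def InputB (H : ℕ → ℕ) : Prop :=
  ∀ (j : Fin I.n) (k : Fin I.d), H ((j : ℕ) * I.d + k + (g.D + 3 + I.n * I.d)) = (I.B j k).toNat

/-- Level 1 of `x` as a Boolean function of the position `q'` inside `VG`/`S`: the period of
coordinate `k = q' / 4015` (`γ₁ = 200`, coordinate words of length `5`). [folklore] -/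
def xBit₁ (hn : 0 < I.n) (i₃ sel q' : ℕ) : Bool :=
  edBit 200 400 800 805 1605
    (fun t => xBit (decide (sel = 1)) (decide (q' / 4015 < I.d)) (aBit I hn i₃ (q' / 4015)) t) (q' % 4015)

/-- Level 2 of `x` as a Boolean function of the position `q` inside `NVG(a_{i₃ mod n})`: the level-2
period of block `sel = q / per'` (`S` for `0`, `VG` for `1`). [folklore] -/
def xBit₂ (hn : 0 < I.n) (i₃ q : ℕ) : Bool :=
  edBit g.q₂.γ₁ (g.q₂.γ₁ + g.q₂.γ₁) g.F₂ (g.F₂ + g.q₂.ℓx) g.G₂x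
    (fun q' => xBit₁ I hn i₃ (q / g.per₂) q') (q % g.per₂)

/-- Level 3 of `x` as a Boolean function of the position `p`: the level-3 period of block
`i₃ = p / per''`. [folklore] -/
def xBit₃ (hn : 0 < I.n) (p : ℕ) : Bool :=
  edBit g.q₃.γ₁ (g.q₃.γ₁ + g.q₃.γ₁) g.F₃ (g.F₃ + g.q₃.ℓx) g.G₃
    (fun q => xBit₂ g I hn (p / g.per₃) q) (p % g.per₃)

set_option maxHeartbeats 800000 in
/-- **Certificate of `innerX1`** (the code of `LCSRed.innerX1` under this file's constants).
[folklore] -/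
theorem innerX1_spec {R H : ℕ → ℕ} (hg : g.n = I.n ∧ g.d = I.d) (hC : g.Consts R) (hn : 0 < I.n)
    (hA : InputA g I H) {t k i₃ sel T : ℕ} (h6 : R 6 = t) (h9 : R 9 = k) (h7 : R 7 = i₃)
    (h8 : R 8 = sel) (h5 : R 5 = T) (hk : k ≤ I.d) (hT : 100 ≤ T) (hD : 100 ≤ g.D)
    (hB : g.BND < 2 ^ W) :
    Achieves W O (block innerX1) (merge R H)
      (Post S₁ R (Function.update H T
        (xBit (decide (sel = 1)) (decide (k < I.d)) (aBit I hn i₃ k) t).toNat)) 21 := by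
  obtain ⟨hgn, hgd⟩ := hg
  have hBND : 10 * (g.D + g.n + g.d + g.n * g.d) + 10000 ≤ g.BND := by unfold Geo.BND; omega
  have hW : 1 < 2 ^ W := by omega
  have h10 : R 10 = I.n := (hC 10 (by decide)).trans hgn
  have h11 : R 11 = I.d := (hC 11 (by decide)).trans hgd
  have h13 : R 13 = g.D + 3 := hC 13 (by decide)
  have hi : i₃ % I.n < I.n := Nat.mod_lt _ hn
  have hid : i₃ % I.n * I.d + I.d ≤ I.n * I.d := by
    have := Nat.mul_le_mul_right I.d hi; rw [Nat.succ_mul] at this; exact this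
  have hnd : I.n * I.d = g.n * g.d := by rw [hgn, hgd]
  refine achieves_block_of_eq' (fun m' hm' => ?_) (by decide)
  simp (disch := first | omega | decide) only [innerX1, execOps_cons, execOps_nil, execOp,
    Operand.write, Operand.read, merge_apply_of_lt, merge_apply_of_le, update_merge_of_lt,
    update_merge_of_le, Function.update_self, Function.update_of_ne, BinOp.eval_add_of_lt,
    BinOp.eval_mul_of_lt, BinOp.eval_mod, BinOp.eval_band, BinOp.eval_lt, BinOp.eval_eq,
    h10, h11, h13, h6, h9, h7, h8, h5] at hm'
  simp only [Nat.and_one_is_mod, Nat.mod_two_of_bodd, CliqueRed.ite_eq_toNat_decide, CliqueRed.toNat_and_toNat, eval_bor_toNat hW,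
    Bool.toNat_eq_zero, Bool.decide_eq_false, Bool.and_self] at hm'
  refine ⟨_, hm'.trans (congrArg _ ?_), fun a ha => ?_⟩
  · -- the written bit is `xBit`, reading `a[k]` from the input when `k < d`
    congr 2
    unfold xBit aBit
    by_cases hkd : k < I.d
    · have := hA ⟨i₃ % I.n, hi⟩ ⟨k, hkd⟩
      simp only [] at this
      rw [this, bodd_toNat, dif_pos hkd]
    · simp only [hkd, decide_false, Bool.false_and, Bool.false_or, dif_neg, not_false_eq_true]
  · simp only [S₁, List.mem_cons, List.not_mem_nil, or_false, not_or] at ha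
    obtain ⟨_, _, _, _, _, _, _, _, _, _⟩ := ha
    simp (disch := omega) only [Function.update_of_ne]

/-- Level 2 of the `x` loop: coordinate `9 := q' / 4015`, bit index `6 := q' % 4015`, then the
dispatch of the level-1 period around `innerX1`. [folklore] -/
def innerX2 : SProg :=
  seqs [block [(.div, r 9, r 6, r 35), (.mod, r 6, r 6, r 35)], edWay 6 5 30 31 32 33 34 (block innerX1)]

/-- The registers written by `innerX2`. [folklore] -/
def S₂ : List ℕ := 9 :: 6 :: 2 :: 20 :: 6 :: S₁

set_option maxHeartbeats 800000 in
/-- **Certificate of `innerX2`.** [folklore] -/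
theorem innerX2_spec {R H : ℕ → ℕ} (hg : g.n = I.n ∧ g.d = I.d) (hC : g.Consts R) (hn : 0 < I.n)
    (hA : InputA g I H) {q i₃ sel T : ℕ} (h6 : R 6 = q) (h7 : R 7 = i₃) (h8 : R 8 = sel) (h5 : R 5 = T)
    (hqd : q / 4015 ≤ I.d) (hT : 100 ≤ T) (hD : 100 ≤ g.D) (hB : g.BND < 2 ^ W) (hq : q < 2 ^ W) :
    Achieves W O innerX2 (merge R H)
      (Post S₂ R (Function.update H T (xBit₁ I hn i₃ sel q).toNat)) 30 := by
  have hW2 : 2 ≤ 2 ^ W := by have : g.BND ≥ 10000 := by unfold Geo.BND; omega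
                             omega
  have h35 : R 35 = 4015 := hC 35 (by decide)
  unfold innerX2
  refine Achieves.seqs_cons (T₁ := 2) (T₂ := 28)
    (R := fun m => m = merge (Function.update (Function.update R 9 (q / 4015)) 6 (q % 4015)) H)
    (achieves_block_of_eq' (fun m' hm' => ?_) (by decide)) fun m hm => ?_
  · simp (disch := first | omega | decide) only [execOps_cons, execOps_nil, execOp, Operand.write,
      Operand.read, merge_apply_of_lt, update_merge_of_lt, Function.update_of_ne, BinOp.eval_div,
      BinOp.eval_mod, h6, h35] at hm'
    exact hm'
  subst hm
  refine Achieves.seqs_cons (T₁ := 28) (T₂ := 0) ?_ fun m hm => Achieves.seqs_nil hm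
  have hK₁ : Kept [9, 6] R (Function.update (Function.update R 9 (q / 4015)) 6 (q % 4015)) :=
    (Kept.rfl.update (by simp) _).update (by simp) _
  have hC₁ := hC.of_kept (S := [9, 6]) (by decide) hK₁
  have h5₁ : Function.update (Function.update R 9 (q / 4015)) 6 (q % 4015) 5 = T := by
    rw [Function.update_of_ne (by decide), Function.update_of_ne (by decide), h5]
  have key := edWay_spec (W := W) (O := O) (rr := 6) (tgt := 5) (g₁ := 30) (g₂ := 31) (b₁ := 32)
    (b₂ := 33) (b₃ := 34) (inner := block innerX1)
    (R := Function.update (Function.update R 9 (q / 4015)) 6 (q % 4015)) (H := H) (rv := q % 4015)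
    (vg₁ := 200) (vg₂ := 400) (v₁ := 800) (v₂ := 805) (v₃ := 1605) (Tin := 21)
    (zb := fun t => xBit (decide (sel = 1)) (decide (q / 4015 < I.d)) (aBit I hn i₃ (q / 4015)) t)
    (Sin := S₁) (by decide) (by decide) (by decide) (by decide) (by decide) (by decide) (by decide)
    (by decide) (by decide) (by decide) (by decide) (by decide) (by decide) (by decide) (by decide)
    (by decide) (by decide) (by decide) (by decide) (by decide) (by decide)
    (by rw [Function.update_self]) (hC₁ 30 (by decide)) (hC₁ 31 (by decide)) (hC₁ 32 (by decide))
    (hC₁ 33 (by decide)) (hC₁ 34 (by decide)) (by rw [h5₁]; exact hT) hW2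
    (lt_of_le_of_lt (Nat.mod_le _ _) hq) (by decide)
    (fun hge hlt R' hK' h6' => by
      have hC' := hC₁.of_kept (S := [2, 6]) (by decide) hK'
      have h9' : R' 9 = q / 4015 := by
        rw [hK' 9 (by decide), Function.update_of_ne (by decide), Function.update_self]
      have h7' : R' 7 = i₃ := by
        rw [hK' 7 (by decide), Function.update_of_ne (by decide), Function.update_of_ne (by decide), h7]
      have h8' : R' 8 = sel := by
        rw [hK' 8 (by decide), Function.update_of_ne (by decide), Function.update_of_ne (by decide), h8]
      have h5' : R' 5 = T := by rw [hK' 5 (by decide), h5₁]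
      have := innerX1_spec (O := O) g I hg hC' hn hA h6' h9' h7' h8' h5' hqd hT hD hB
      rwa [h5₁])
  rw [h5₁] at key
  refine key.mono (fun m hm => ?_) le_rfl
  obtain ⟨R', hm, hK'⟩ := hm
  exact ⟨R', hm, hK₁.trans hK'⟩

/-- Level 3 of the `x` loop: block of level 2 `8 := q / per'` (`0 = S`, `1 = VG`), offset
`6 := q % per'`, then the dispatch of the level-2 period around `innerX2`. [folklore] -/
def innerX3 : SProg :=
  seqs [block [(.div, r 8, r 6, r 45), (.mod, r 6, r 6, r 45)], edWay 6 5 40 41 42 43 44 innerX2]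

/-- The registers written by `innerX3`. [folklore] -/
def S₃ : List ℕ := 8 :: 6 :: 2 :: 20 :: 6 :: S₂

set_option maxHeartbeats 800000 in
/-- **Certificate of `innerX3`.** [folklore] -/
theorem innerX3_spec {R H : ℕ → ℕ} (hg : g.n = I.n ∧ g.d = I.d) (hC : g.Consts R) (hn : 0 < I.n)
    (hA : InputA g I H) {q i₃ T : ℕ} (h6 : R 6 = q) (h7 : R 7 = i₃) (h5 : R 5 = T) (hT : 100 ≤ T)
    (hD : 100 ≤ g.D) (hB : g.BND < 2 ^ W) (hq : q < 2 ^ W) :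
    Achieves W O innerX3 (merge R H) (Post S₃ R (Function.update H T (xBit₂ g I hn i₃ q).toNat)) 39 := by
  have hW2 : 2 ≤ 2 ^ W := by have : g.BND ≥ 10000 := by unfold Geo.BND; omega
                             omega
  have h45 : R 45 = g.per₂ := hC 45 (by decide)
  unfold innerX3
  refine Achieves.seqs_cons (T₁ := 2) (T₂ := 37)
    (R := fun m => m = merge (Function.update (Function.update R 8 (q / g.per₂)) 6 (q % g.per₂)) H)
    (achieves_block_of_eq' (fun m' hm' => ?_) (by decide)) fun m hm => ?_
  · simp (disch := first | omega | decide) only [execOps_cons, execOps_nil, execOp, Operand.write,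
      Operand.read, merge_apply_of_lt, update_merge_of_lt, Function.update_of_ne, BinOp.eval_div,
      BinOp.eval_mod, h6, h45] at hm'
    exact hm'
  subst hm
  refine Achieves.seqs_cons (T₁ := 37) (T₂ := 0) ?_ fun m hm => Achieves.seqs_nil hm
  have hK₁ : Kept [8, 6] R (Function.update (Function.update R 8 (q / g.per₂)) 6 (q % g.per₂)) :=
    (Kept.rfl.update (by simp) _).update (by simp) _
  have hC₁ := hC.of_kept (S := [8, 6]) (by decide) hK₁
  have h5₁ : Function.update (Function.update R 8 (q / g.per₂)) 6 (q % g.per₂) 5 = T := by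
    rw [Function.update_of_ne (by decide), Function.update_of_ne (by decide), h5]
  have key := edWay_spec (W := W) (O := O) (rr := 6) (tgt := 5) (g₁ := 40) (g₂ := 41) (b₁ := 42)
    (b₂ := 43) (b₃ := 44) (inner := innerX2)
    (R := Function.update (Function.update R 8 (q / g.per₂)) 6 (q % g.per₂)) (H := H) (rv := q % g.per₂)
    (vg₁ := g.q₂.γ₁) (vg₂ := g.q₂.γ₁ + g.q₂.γ₁) (v₁ := g.F₂) (v₂ := g.F₂ + g.q₂.ℓx) (v₃ := g.G₂x)
    (Tin := 30) (zb := fun q' => xBit₁ I hn i₃ (q / g.per₂) q') (Sin := S₂)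
    (by decide) (by decide) (by decide) (by decide) (by decide) (by decide) (by decide)
    (by decide) (by decide) (by decide) (by decide) (by decide) (by decide) (by decide) (by decide)
    (by decide) (by decide) (by decide) (by decide) (by decide) (by decide)
    (by rw [Function.update_self]) (hC₁ 40 (by decide)) (hC₁ 41 (by decide)) (hC₁ 42 (by decide))
    (hC₁ 43 (by decide)) (hC₁ 44 (by decide)) (by rw [h5₁]; exact hT) hW2
    (lt_of_le_of_lt (Nat.mod_le _ _) hq) (by decide)
    (fun hge hlt R' hK' h6' => by
      have hC' := hC₁.of_kept (S := [2, 6]) (by decide) hK'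
      have h8' : R' 8 = q / g.per₂ := by
        rw [hK' 8 (by decide), Function.update_of_ne (by decide), Function.update_self]
      have h7' : R' 7 = i₃ := by
        rw [hK' 7 (by decide), Function.update_of_ne (by decide), Function.update_of_ne (by decide), h7]
      have h5' : R' 5 = T := by rw [hK' 5 (by decide), h5₁]
      have hqd : (q % g.per₂ - g.F₂) / 4015 ≤ I.d := by
        rw [← hg.2]
        have hℓ := g.q₂_ℓx
        have : (q % g.per₂ - g.F₂) / 4015 < g.d + 1 := (Nat.div_lt_iff_lt_mul (by decide)).2 (by omega)
        omega
      have := innerX2_spec (O := O) g I hg hC' hn hA h6' h7' h8' h5' hqd hT hD hB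
        (by have := Nat.mod_le q g.per₂; omega)
      rwa [h5₁])
  rw [h5₁] at key
  refine key.mono (fun m hm => ?_) le_rfl
  obtain ⟨R', hm, hK'⟩ := hm
  exact ⟨R', hm, hK₁.trans hK'⟩

/-- **The body of the `x` loop**: level-3 block `7 := p / per''`, offset `6 := p % per''`, target
`5 := Q + 1 + p`; the dispatch of the level-3 period around `innerX3`; then `3 += 1`, `4 -= 1`.
[folklore] -/
def bodyX : SProg :=
  seqs [block [(.div, r 7, r 3, r 55), (.mod, r 6, r 3, r 55), (.add, r 5, r 75, r 3)],
    edWay 6 5 50 51 52 53 54 innerX3, block [(.add, r 3, r 3, im 1), (.sub, r 4, r 4, im 1)]]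

/-- `bodyX` is query-free. [folklore] -/
theorem bodyX_queryFree : bodyX.QueryFree := by
  refine seqs_queryFree fun s hs => ?_
  simp only [List.mem_cons, List.not_mem_nil, or_false] at hs
  rcases hs with rfl | rfl | rfl
  · exact block_queryFree _
  · refine edWay_queryFree (seqs_queryFree fun s hs => ?_)
    simp only [List.mem_cons, List.not_mem_nil, or_false] at hs
    rcases hs with rfl | rfl
    · exact block_queryFree _
    · refine edWay_queryFree (seqs_queryFree fun s hs => ?_)
      simp only [List.mem_cons, List.not_mem_nil, or_false] at hs
      rcases hs with rfl | rfl
      · exact block_queryFree _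
      · exact edWay_queryFree (block_queryFree _)
  · exact block_queryFree _

set_option maxHeartbeats 800000 in
/-- **Certificate of the body of the `x` loop**: from `3 = p < LX`, `4 = c` it writes the word of
`xBit₃ p` at `Q + 1 + p` and leaves `3 = p + 1`, `4 = c - 1`, all constants kept, within `51`
steps. [folklore] -/
theorem bodyX_spec {R H : ℕ → ℕ} (hg : g.n = I.n ∧ g.d = I.d) (hC : g.Consts R) (hn : 0 < I.n)
    (hA : InputA g I H) {p c : ℕ} (h3 : R 3 = p) (h4 : R 4 = c) (hp : p < g.LX) (hc : 1 ≤ c)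
    (hcW : c < 2 ^ W) (hD : 100 ≤ g.D) (hB : g.BND < 2 ^ W) :
    Achieves W O bodyX (merge R H)
      (fun m => ∃ R', m = merge R' (Function.update H (g.Q + 1 + p) (xBit₃ g I hn p).toNat) ∧
        g.Consts R' ∧ R' 3 = p + 1 ∧ R' 4 = c - 1) 51 := by
  have hBND : 10 * (g.D + g.LX + g.Q) + 10000 ≤ g.BND := by unfold Geo.BND; omega
  have hW2 : 2 ≤ 2 ^ W := by omega
  have h55 : R 55 = g.per₃ := hC 55 (by decide)
  have h75 : R 75 = g.Q + 1 := hC 75 (by decide)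
  unfold bodyX
  refine Achieves.seqs_cons (T₁ := 3) (T₂ := 48)
    (R := fun m => m = merge (Function.update (Function.update (Function.update R 7
      (p / g.per₃)) 6 (p % g.per₃)) 5 (g.Q + 1 + p)) H)
    (achieves_block_of_eq' (fun m' hm' => ?_) (by decide)) fun m hm => ?_
  · simp (disch := first | omega | decide) only [execOps_cons, execOps_nil, execOp, Operand.write,
      Operand.read, merge_apply_of_lt, update_merge_of_lt, Function.update_of_ne, BinOp.eval_div,
      BinOp.eval_mod, BinOp.eval_add_of_lt, h3, h55, h75] at hm'
    exact hm'
  subst hm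
  set R₁ := Function.update (Function.update (Function.update R 7 (p / g.per₃)) 6 (p % g.per₃)) 5
    (g.Q + 1 + p) with hR₁
  have hK₁ : Kept [7, 6, 5] R R₁ :=
    ((Kept.rfl.update (by simp) _).update (by simp) _).update (by simp) _
  have hC₁ := hC.of_kept (S := [7, 6, 5]) (by decide) hK₁
  have h5₁ : R₁ 5 = g.Q + 1 + p := by rw [hR₁, Function.update_self]
  refine Achieves.seqs_cons (T₁ := 46) (T₂ := 2)
    (R := Post (2 :: 20 :: 6 :: S₃) R₁ (Function.update H (g.Q + 1 + p) (xBit₃ g I hn p).toNat)) ?_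
    fun m hm => ?_
  · have key := edWay_spec (W := W) (O := O) (rr := 6) (tgt := 5) (g₁ := 50) (g₂ := 51) (b₁ := 52)
      (b₂ := 53) (b₃ := 54) (inner := innerX3) (R := R₁) (H := H) (rv := p % g.per₃)
      (vg₁ := g.q₃.γ₁) (vg₂ := g.q₃.γ₁ + g.q₃.γ₁) (v₁ := g.F₃) (v₂ := g.F₃ + g.q₃.ℓx) (v₃ := g.G₃)
      (Tin := 39) (zb := fun q => xBit₂ g I hn (p / g.per₃) q) (Sin := S₃)
      (by decide) (by decide) (by decide) (by decide) (by decide) (by decide) (by decide)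
      (by decide) (by decide) (by decide) (by decide) (by decide) (by decide) (by decide) (by decide)
      (by decide) (by decide) (by decide) (by decide) (by decide) (by decide)
      (by rw [hR₁, Function.update_of_ne (by decide), Function.update_self])
      (hC₁ 50 (by decide)) (hC₁ 51 (by decide)) (hC₁ 52 (by decide)) (hC₁ 53 (by decide))
      (hC₁ 54 (by decide)) (by rw [h5₁]; unfold Geo.Q; omega) hW2
      (by have := Nat.mod_le p g.per₃; omega) (by decide)
      (fun hge hlt R' hK' h6' => by
        have hC' := hC₁.of_kept (S := [2, 6]) (by decide) hK'
        have h7' : R' 7 = p / g.per₃ := by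
          rw [hK' 7 (by decide), hR₁, Function.update_of_ne (by decide), Function.update_of_ne (by decide),
            Function.update_self]
        have h5' : R' 5 = g.Q + 1 + p := by rw [hK' 5 (by decide), h5₁]
        have := innerX3_spec (O := O) g I hg hC' hn hA h6' h7' h5' (by unfold Geo.Q; omega) hD hB
          (by have := Nat.mod_le p g.per₃; omega)
        rwa [h5₁])
    rw [h5₁] at key
    exact key
  · obtain ⟨R₂, hm, hK₂⟩ := hm
    subst hm
    have hC₂ := hC₁.of_kept (S := 2 :: 20 :: 6 :: S₃) (by decide) hK₂
    have h3₂ : R₂ 3 = p := by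
      rw [hK₂ 3 (by decide), hR₁, Function.update_of_ne (by decide), Function.update_of_ne (by decide),
        Function.update_of_ne (by decide), h3]
    have h4₂ : R₂ 4 = c := by
      rw [hK₂ 4 (by decide), hR₁, Function.update_of_ne (by decide), Function.update_of_ne (by decide),
        Function.update_of_ne (by decide), h4]
    refine Achieves.seqs_cons (T₁ := 2) (T₂ := 0) (achieves_block_of_eq' (fun m' hm' => ?_) (by decide))
      fun m hm => Achieves.seqs_nil hm
    simp (disch := first | omega | decide) only [execOps_cons, execOps_nil, execOp, Operand.write,
      Operand.read, merge_apply_of_lt, update_merge_of_lt, Function.update_of_ne, BinOp.eval_add_of_lt,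
      BinOp.eval_sub_of_le, h3₂, h4₂] at hm'
    subst hm'
    refine ⟨_, rfl, hC₂.of_kept (S := [3, 4]) (by decide)
      ((Kept.rfl.update (by simp) _).update (by simp) _), ?_, ?_⟩
    · rw [Function.update_of_ne (by decide), Function.update_self]
    · rw [Function.update_self]

end xloop

/-! ### The `x` loop -/

section xloop2

variable {W : ℕ} {O : List ℕ → List ℕ} (g : Geo) (I : OVInstance)

/-- The `x` loop: `LX` iterations of `bodyX`. [folklore] -/
def loopX : SProg := whilenz (r 4) bodyX

/-- `loopX` is query-free. [folklore] -/
theorem loopX_queryFree : loopX.QueryFree := bodyX_queryFree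

/-- The data memory after `i` iterations of the `x` loop: the words of `xBit₃ p`, `p < i`, at
`Q + 1 + p`. [folklore] -/
def xData (hn : 0 < I.n) (H₀ : ℕ → ℕ) (i : ℕ) : ℕ → ℕ := fun a =>
  if g.Q + 1 ≤ a ∧ a < g.Q + 1 + i then (xBit₃ g I hn (a - (g.Q + 1))).toNat else H₀ a

/-- Before the `x` loop the data are untouched. [folklore] -/
theorem xData_zero (hn : 0 < I.n) (H₀ : ℕ → ℕ) : xData g I hn H₀ 0 = H₀ := by
  funext a; unfold xData; rw [if_neg (by omega)]

/-- One more iteration of the `x` loop in the data. [folklore] -/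
theorem xData_succ (hn : 0 < I.n) (H₀ : ℕ → ℕ) (i : ℕ) :
    Function.update (xData g I hn H₀ i) (g.Q + 1 + i) (xBit₃ g I hn i).toNat = xData g I hn H₀ (i + 1) := by
  funext a
  unfold xData
  by_cases ha : a = g.Q + 1 + i
  · subst ha; rw [Function.update_self, if_pos ⟨by omega, by omega⟩]; congr 2; omega
  · rw [Function.update_of_ne ha]
    by_cases h1 : g.Q + 1 ≤ a ∧ a < g.Q + 1 + i
    · rw [if_pos h1, if_pos ⟨h1.1, by omega⟩]
    · rw [if_neg h1, if_neg (by omega)]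

/-- The input bits of `A` sit below the query base, so the `x` loop does not disturb them. [folklore] -/
theorem inputA_xData (hn : 0 < I.n) {H₀ : ℕ → ℕ} (hA : InputA g I H₀) (hg : g.n = I.n ∧ g.d = I.d)
    (hL : 2 + 2 * (g.n * g.d) ≤ g.L) (i : ℕ) : InputA g I (xData g I hn H₀ i) := by
  intro i' k
  have h1 : (i' : ℕ) * I.d + I.d ≤ I.n * I.d := by
    have := Nat.mul_le_mul_right I.d i'.isLt; rw [Nat.succ_mul] at this; exact this
  have h2 : I.n * I.d = g.n * g.d := by rw [hg.1, hg.2]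
  have hk := k.isLt
  unfold xData
  rw [if_neg (by unfold Geo.Q; omega)]
  exact hA i' k

/-- **Certificate of the `x` loop.** From `3 = 0`, `4 = LX` and the constants, it leaves the words
of `xBit₃ p`, `p < LX`, at `Q + 1 + p`, `3 = LX`, `4 = 0`, constants kept, within `53 LX + 1`
steps. [folklore] -/
theorem loopX_spec {R H : ℕ → ℕ} (hg : g.n = I.n ∧ g.d = I.d) (hC : g.Consts R) (hn : 0 < I.n)
    (hA : InputA g I H) (h3 : R 3 = 0) (h4 : R 4 = g.LX) (hL : 2 + 2 * (g.n * g.d) ≤ g.L)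
    (hD : 100 ≤ g.D) (hB : g.BND < 2 ^ W) :
    Achieves W O loopX (merge R H)
      (fun m => ∃ R', m = merge R' (xData g I hn H g.LX) ∧ g.Consts R' ∧ R' 3 = g.LX ∧ R' 4 = 0)
      (g.LX * 53 + 1) := by
  have hLX : g.LX < 2 ^ W := by unfold Geo.BND at hB; omega
  refine Achieves.whilenz g.LX 51
    (fun i m => ∃ R', m = merge R' (xData g I hn H i) ∧ g.Consts R' ∧ R' 3 = i ∧ R' 4 = g.LX - i)
    (fun i hi m ⟨R', hm, hC', h3', h4'⟩ => ⟨?_, ?_⟩) (fun m ⟨R', hm, _, _, h4'⟩ => ?_)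
    ⟨R, by rw [xData_zero], hC, h3, by rw [h4]; omega⟩
    (fun m ⟨R', hm, hC', h3', h4'⟩ => ⟨R', hm, hC', h3', h4'.trans (Nat.sub_self _)⟩) le_rfl
  · subst hm; simp only [Operand.read, merge_apply_of_lt (show (4 : ℕ) < 100 by decide), h4']; omega
  · subst hm
    have := bodyX_spec (O := O) g I hg hC' hn (inputA_xData g I hn hA hg hL i) h3' h4' hi (by omega)
      (by omega) hD hB
    refine this.mono (fun m ⟨R'', hm, hC'', h3'', h4''⟩ => ⟨R'', ?_, hC'', h3'', by omega⟩) le_rfl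
    rw [hm, xData_succ]
  · subst hm; simp only [Operand.read, merge_apply_of_lt (show (4 : ℕ) < 100 by decide), h4', Nat.sub_self]

end xloop2


/-! ### Writing `ovY I`: the loop body -/

section yloop

variable {W : ℕ} {O : List ℕ → List ℕ} (g : Geo) (I : OVInstance)

/-- Level 1 of `y`: position `q'` inside the core of `VG(b_j)` (blocks of coordinates). [folklore] -/
def yBit₁ (j q' : ℕ) : Bool :=
  edBit 200 400 800 805 1605 (fun t => yBit (decide (q' / 4015 < I.d)) (bBit I j (q' / 4015)) t) (q' % 4015)

/-- `VG(b_j) = 0^{4820(d+1)} core 0^{4820(d+1)}` bitwise. [folklore] -/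
def yBit₂ (j q : ℕ) : Bool :=
  threeBit g.pad₁ (g.pad₁ + g.q₂.ℓx) (fun q' => yBit₁ I j q') q

/-- `G'(VG(b_j))` (followed by zeros) bitwise: the level-2 period, `y` side. [folklore] -/
def yBit₃ (j q : ℕ) : Bool :=
  edBit g.q₂.γ₁ (g.q₂.γ₁ + g.q₂.γ₁) g.F₂ (g.F₂ + g.q₂.ℓy) g.G₂y (fun q' => yBit₂ g I j q') q

/-- `NVG(b_j) = 0^{2γ₃'} G'(VG(b_j)) 0^{2γ₃'}` bitwise. [folklore] -/
def yBit₄ (j q : ℕ) : Bool :=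
  threeBit g.pad₂ (g.pad₂ + g.G₂y) (fun q' => yBit₃ g I j q') q

/-- The core `G''(NVG(b₀)) 0^{γ₂''} ⋯ G''(NVG(b_{n-1}))` of `y` bitwise: block `j = q / per''_y`.
[folklore] -/
def yBit₅ (q : ℕ) : Bool :=
  edBit g.q₃.γ₁ (g.q₃.γ₁ + g.q₃.γ₁) g.F₃ (g.F₃ + g.q₃.ℓy) g.G₃y
    (fun q' => yBit₄ g I (q / g.per₃y) q') (q % g.per₃y)

/-- `y = 0^{NP} core 0^{NP}` bitwise. [folklore] -/
def yBit₆ (p : ℕ) : Bool :=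
  threeBit g.NP (g.NP + g.LC) (fun q => yBit₅ g I q) p

set_option maxHeartbeats 800000 in
/-- **Certificate of `innerY1`** (the code of `LCSRed.innerY1` under this file's constants).
[folklore] -/
theorem innerY1_spec {R H : ℕ → ℕ} (hg : g.n = I.n ∧ g.d = I.d) (hC : g.Consts R)
    (hIB : InputB g I H) {t k j T : ℕ} (h6 : R 6 = t) (h9 : R 9 = k) (h7 : R 7 = j) (h5 : R 5 = T)
    (hk : k ≤ I.d) (hj : j < I.n) (hT : 100 ≤ T) (hD : 100 ≤ g.D) (hB : g.BND < 2 ^ W) :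
    Achieves W O (block innerY1) (merge R H)
      (Post S₁ R (Function.update H T (yBit (decide (k < I.d)) (bBit I j k) t).toNat)) 17 := by
  obtain ⟨hgn, hgd⟩ := hg
  have hBND : 10 * (g.D + g.n + g.d + g.n * g.d) + 10000 ≤ g.BND := by unfold Geo.BND; omega
  have hW : 1 < 2 ^ W := by omega
  have h11 : R 11 = I.d := (hC 11 (by decide)).trans hgd
  have h15 : R 15 = g.D + 3 + I.n * I.d := by rw [hC 15 (by decide)]; simp [Geo.KR, hgn, hgd]
  have hjd : j * I.d + I.d ≤ I.n * I.d := by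
    have := Nat.mul_le_mul_right I.d hj; rw [Nat.succ_mul] at this; exact this
  have hnd : I.n * I.d = g.n * g.d := by rw [hgn, hgd]
  refine achieves_block_of_eq' (fun m' hm' => ?_) (by decide)
  simp (disch := first | omega | decide) only [innerY1, execOps_cons, execOps_nil, execOp,
    Operand.write, Operand.read, merge_apply_of_lt, merge_apply_of_le, update_merge_of_lt,
    update_merge_of_le, Function.update_self, Function.update_of_ne, BinOp.eval_add_of_lt,
    BinOp.eval_mul_of_lt, BinOp.eval_band, BinOp.eval_lt, BinOp.eval_eq,
    h11, h15, h6, h9, h7, h5] at hm'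
  simp only [Nat.and_one_is_mod, Nat.mod_two_of_bodd, CliqueRed.ite_eq_toNat_decide, CliqueRed.toNat_and_toNat, eval_bor_toNat hW,
    Bool.toNat_eq_zero, Bool.decide_eq_false, Bool.and_self] at hm'
  refine ⟨_, hm'.trans (congrArg _ ?_), fun a ha => ?_⟩
  · congr 2
    unfold yBit bBit
    by_cases hkd : k < I.d
    · have := hIB ⟨j, hj⟩ ⟨k, hkd⟩
      simp only [] at this
      rw [this, bodd_toNat, dif_pos ⟨hj, hkd⟩]
    · simp only [hkd, decide_false, Bool.false_and, Bool.false_or, and_false, dif_neg, not_false_eq_true]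
  · simp only [S₁, List.mem_cons, List.not_mem_nil, or_false, not_or] at ha
    obtain ⟨_, _, _, _, _, _, _, _, _, _⟩ := ha
    simp (disch := omega) only [Function.update_of_ne]

/-- Level 1 of the `y` loop (inside the core of `VG(b_j)`): coordinate `9 := q' / 4015`, bit index
`6 := q' % 4015`, the dispatch of the level-1 period around `innerY1`. [folklore] -/
def innerY1c : SProg :=
  seqs [block [(.div, r 9, r 6, r 35), (.mod, r 6, r 6, r 35)], edWay 6 5 30 31 32 33 34 (block innerY1)]

set_option maxHeartbeats 800000 in
/-- **Certificate of `innerY1c`.** [folklore] -/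
theorem innerY1c_spec {R H : ℕ → ℕ} (hg : g.n = I.n ∧ g.d = I.d) (hC : g.Consts R)
    (hIB : InputB g I H) {q j T : ℕ} (h6 : R 6 = q) (h7 : R 7 = j) (h5 : R 5 = T) (hqd : q / 4015 ≤ I.d)
    (hj : j < I.n) (hT : 100 ≤ T) (hD : 100 ≤ g.D) (hB : g.BND < 2 ^ W) (hq : q < 2 ^ W) :
    Achieves W O innerY1c (merge R H) (Post S₂ R (Function.update H T (yBit₁ I j q).toNat)) 26 := by
  have hW2 : 2 ≤ 2 ^ W := by have : g.BND ≥ 10000 := by unfold Geo.BND; omega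
                             omega
  have h35 : R 35 = 4015 := hC 35 (by decide)
  unfold innerY1c
  refine Achieves.seqs_cons (T₁ := 2) (T₂ := 24)
    (R := fun m => m = merge (Function.update (Function.update R 9 (q / 4015)) 6 (q % 4015)) H)
    (achieves_block_of_eq' (fun m' hm' => ?_) (by decide)) fun m hm => ?_
  · simp (disch := first | omega | decide) only [execOps_cons, execOps_nil, execOp, Operand.write,
      Operand.read, merge_apply_of_lt, update_merge_of_lt, Function.update_of_ne, BinOp.eval_div,
      BinOp.eval_mod, h6, h35] at hm'
    exact hm'
  subst hm
  refine Achieves.seqs_cons (T₁ := 24) (T₂ := 0) ?_ fun m hm => Achieves.seqs_nil hm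
  have hK₁ : Kept [9, 6] R (Function.update (Function.update R 9 (q / 4015)) 6 (q % 4015)) :=
    (Kept.rfl.update (by simp) _).update (by simp) _
  have hC₁ := hC.of_kept (S := [9, 6]) (by decide) hK₁
  have h5₁ : Function.update (Function.update R 9 (q / 4015)) 6 (q % 4015) 5 = T := by
    rw [Function.update_of_ne (by decide), Function.update_of_ne (by decide), h5]
  have key := edWay_spec (W := W) (O := O) (rr := 6) (tgt := 5) (g₁ := 30) (g₂ := 31) (b₁ := 32)
    (b₂ := 33) (b₃ := 34) (inner := block innerY1)
    (R := Function.update (Function.update R 9 (q / 4015)) 6 (q % 4015)) (H := H) (rv := q % 4015)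
    (vg₁ := 200) (vg₂ := 400) (v₁ := 800) (v₂ := 805) (v₃ := 1605) (Tin := 17)
    (zb := fun t => yBit (decide (q / 4015 < I.d)) (bBit I j (q / 4015)) t)
    (Sin := S₁) (by decide) (by decide) (by decide) (by decide) (by decide) (by decide) (by decide)
    (by decide) (by decide) (by decide) (by decide) (by decide) (by decide) (by decide) (by decide)
    (by decide) (by decide) (by decide) (by decide) (by decide) (by decide)
    (by rw [Function.update_self]) (hC₁ 30 (by decide)) (hC₁ 31 (by decide)) (hC₁ 32 (by decide))
    (hC₁ 33 (by decide)) (hC₁ 34 (by decide)) (by rw [h5₁]; exact hT) hW2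
    (lt_of_le_of_lt (Nat.mod_le _ _) hq) (by decide)
    (fun hge hlt R' hK' h6' => by
      have hC' := hC₁.of_kept (S := [2, 6]) (by decide) hK'
      have h9' : R' 9 = q / 4015 := by
        rw [hK' 9 (by decide), Function.update_of_ne (by decide), Function.update_self]
      have h7' : R' 7 = j := by
        rw [hK' 7 (by decide), Function.update_of_ne (by decide), Function.update_of_ne (by decide), h7]
      have h5' : R' 5 = T := by rw [hK' 5 (by decide), h5₁]
      have := innerY1_spec (O := O) g I hg hC' hIB h6' h9' h7' h5' hqd hj hT hD hB
      rwa [h5₁])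
  rw [h5₁] at key
  refine key.mono (fun m hm => ?_) le_rfl
  obtain ⟨R', hm, hK'⟩ := hm
  exact ⟨R', hm, hK₁.trans hK'⟩

/-- Levels 2–4 of the `y` loop: inside `NVG(b_j) = 0^{2γ₃'} G'(0^{pad} core 0^{pad}) 0^{2γ₃'}`, three
nested dispatches around `innerY1c`. [folklore] -/
def innerY4 : SProg :=
  threeWay 6 5 48 49 (edWay 6 5 40 41 42 46 47 (threeWay 6 5 36 37 innerY1c))

/-- The registers written by `innerY4`. [folklore] -/
def S₄ : List ℕ := 2 :: 6 :: 2 :: 20 :: 6 :: 2 :: 6 :: S₂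

set_option maxHeartbeats 800000 in
/-- **Certificate of `innerY4`.** [folklore] -/
theorem innerY4_spec {R H : ℕ → ℕ} (hg : g.n = I.n ∧ g.d = I.d) (hC : g.Consts R)
    (hIB : InputB g I H) {q j T : ℕ} (h6 : R 6 = q) (h7 : R 7 = j) (h5 : R 5 = T) (hj : j < I.n)
    (hT : 100 ≤ T) (hD : 100 ≤ g.D) (hB : g.BND < 2 ^ W) (hq : q < 2 ^ W) :
    Achieves W O innerY4 (merge R H) (Post S₄ R (Function.update H T (yBit₄ g I j q).toNat)) 47 := by
  have hW2 : 2 ≤ 2 ^ W := by have : g.BND ≥ 10000 := by unfold Geo.BND; omega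
                             omega
  unfold innerY4
  refine threeWay_spec (W := W) (O := O) (rp := 6) (tgt := 5) (c₁ := 48) (c₂ := 49)
    (inner := edWay 6 5 40 41 42 46 47 (threeWay 6 5 36 37 innerY1c)) (R := R) (H := H) (pv := q)
    (v₁ := g.pad₂) (v₂ := g.pad₂ + g.G₂y) (Tin := 40)
    (cb := fun q' => yBit₃ g I j q') (Sin := 2 :: 20 :: 6 :: 2 :: 6 :: S₂)
    (by decide) (by decide) (by decide) (by decide) (by decide) (by decide) (by decide) (by decide)
    (by decide) h6 (hC 48 (by decide)) (hC 49 (by decide)) (by rw [h5]; exact hT) hW2 hq (by decide)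
    (fun hge₁ hlt₁ R₁ hK₁ h6₁ => ?_) |>.mono (fun m hm => by rw [h5] at hm; exact hm) le_rfl
  rw [h5]
  have hC₁ := hC.of_kept (S := [2, 6]) (by decide) hK₁
  have h5₁ : R₁ 5 = T := by rw [hK₁ 5 (by decide), h5]
  have h7₁ : R₁ 7 = j := by rw [hK₁ 7 (by decide), h7]
  refine edWay_spec (W := W) (O := O) (rr := 6) (tgt := 5) (g₁ := 40) (g₂ := 41) (b₁ := 42) (b₂ := 46)
    (b₃ := 47) (inner := threeWay 6 5 36 37 innerY1c) (R := R₁) (H := H)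
    (rv := q - g.pad₂) (vg₁ := g.q₂.γ₁) (vg₂ := g.q₂.γ₁ + g.q₂.γ₁) (v₁ := g.F₂)
    (v₂ := g.F₂ + g.q₂.ℓy) (v₃ := g.G₂y) (Tin := 33)
    (zb := fun q' => yBit₂ g I j q') (Sin := 2 :: 6 :: S₂)
    (by decide) (by decide) (by decide) (by decide) (by decide) (by decide) (by decide)
    (by decide) (by decide) (by decide) (by decide) (by decide) (by decide) (by decide) (by decide)
    (by decide) (by decide) (by decide) (by decide) (by decide) (by decide)
    h6₁ (hC₁ 40 (by decide)) (hC₁ 41 (by decide))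
    (hC₁ 42 (by decide)) (hC₁ 46 (by decide)) (hC₁ 47 (by decide)) (by rw [h5₁]; exact hT) hW2 (by omega)
    (by decide) (fun hge₂ hlt₂ R₂ hK₂ h6₂ => ?_) |>.mono (fun m hm => by rw [h5₁] at hm; exact hm) le_rfl
  rw [h5₁]
  have hC₂ := hC₁.of_kept (S := [2, 6]) (by decide) hK₂
  have h5₂ : R₂ 5 = T := by rw [hK₂ 5 (by decide), h5₁]
  have h7₂ : R₂ 7 = j := by rw [hK₂ 7 (by decide), h7₁]
  refine threeWay_spec (W := W) (O := O) (rp := 6) (tgt := 5) (c₁ := 36) (c₂ := 37) (inner := innerY1c)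
    (R := R₂) (H := H) (pv := q - g.pad₂ - g.F₂) (v₁ := g.pad₁)
    (v₂ := g.pad₁ + g.q₂.ℓx) (Tin := 26) (cb := fun q' => yBit₁ I j q') (Sin := S₂)
    (by decide) (by decide) (by decide) (by decide) (by decide) (by decide) (by decide) (by decide)
    (by decide) h6₂ (hC₂ 36 (by decide)) (hC₂ 37 (by decide)) (by rw [h5₂]; exact hT) hW2 (by omega)
    (by decide) (fun hge₃ hlt₃ R₃ hK₃ h6₃ => ?_) |>.mono (fun m hm => by rw [h5₂] at hm; exact hm) le_rfl
  rw [h5₂]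
  have hC₃ := hC₂.of_kept (S := [2, 6]) (by decide) hK₃
  have h5₃ : R₃ 5 = T := by rw [hK₃ 5 (by decide), h5₂]
  have h7₃ : R₃ 7 = j := by rw [hK₃ 7 (by decide), h7₂]
  have hqd : (q - g.pad₂ - g.F₂ - g.pad₁) / 4015 ≤ I.d := by
    rw [← hg.2]
    have hℓ := g.q₂_ℓx
    have : (q - g.pad₂ - g.F₂ - g.pad₁) / 4015 < g.d + 1 := (Nat.div_lt_iff_lt_mul (by decide)).2 (by omega)
    omega
  exact innerY1c_spec (O := O) g I hg hC₃ hIB h6₃ h7₃ h5₃ hqd hj hT hD hB (by omega)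

/-- Level 5 of the `y` loop (inside the core of `y`): block `7 := q / per''_y` (the vector `b_j`),
offset `6 := q % per''_y`, the dispatch of the level-3 period around `innerY4`. [folklore] -/
def innerY5 : SProg :=
  seqs [block [(.div, r 7, r 6, r 58), (.mod, r 6, r 6, r 58)], edWay 6 5 50 51 52 56 57 innerY4]

/-- The registers written by `innerY5`. [folklore] -/
def S₅ : List ℕ := 7 :: 6 :: 2 :: 20 :: 6 :: S₄

set_option maxHeartbeats 800000 in
/-- **Certificate of `innerY5`.** [folklore] -/
theorem innerY5_spec {R H : ℕ → ℕ} (hg : g.n = I.n ∧ g.d = I.d) (hC : g.Consts R)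
    (hIB : InputB g I H) {q T : ℕ} (h6 : R 6 = q) (h5 : R 5 = T) (hqn : q / g.per₃y < I.n)
    (hT : 100 ≤ T) (hD : 100 ≤ g.D) (hB : g.BND < 2 ^ W) (hq : q < 2 ^ W) :
    Achieves W O innerY5 (merge R H) (Post S₅ R (Function.update H T (yBit₅ g I q).toNat)) 56 := by
  have hW2 : 2 ≤ 2 ^ W := by have : g.BND ≥ 10000 := by unfold Geo.BND; omega
                             omega
  have h58 : R 58 = g.per₃y := hC 58 (by decide)
  unfold innerY5
  refine Achieves.seqs_cons (T₁ := 2) (T₂ := 54)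
    (R := fun m => m = merge (Function.update (Function.update R 7 (q / g.per₃y)) 6 (q % g.per₃y)) H)
    (achieves_block_of_eq' (fun m' hm' => ?_) (by decide)) fun m hm => ?_
  · simp (disch := first | omega | decide) only [execOps_cons, execOps_nil, execOp, Operand.write,
      Operand.read, merge_apply_of_lt, update_merge_of_lt, Function.update_of_ne, BinOp.eval_div,
      BinOp.eval_mod, h6, h58] at hm'
    exact hm'
  subst hm
  refine Achieves.seqs_cons (T₁ := 54) (T₂ := 0) ?_ fun m hm => Achieves.seqs_nil hm
  have hK₁ : Kept [7, 6] R (Function.update (Function.update R 7 (q / g.per₃y)) 6 (q % g.per₃y)) :=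
    (Kept.rfl.update (by simp) _).update (by simp) _
  have hC₁ := hC.of_kept (S := [7, 6]) (by decide) hK₁
  have h5₁ : Function.update (Function.update R 7 (q / g.per₃y)) 6 (q % g.per₃y) 5 = T := by
    rw [Function.update_of_ne (by decide), Function.update_of_ne (by decide), h5]
  have key := edWay_spec (W := W) (O := O) (rr := 6) (tgt := 5) (g₁ := 50) (g₂ := 51) (b₁ := 52)
    (b₂ := 56) (b₃ := 57) (inner := innerY4)
    (R := Function.update (Function.update R 7 (q / g.per₃y)) 6 (q % g.per₃y)) (H := H)
    (rv := q % g.per₃y) (vg₁ := g.q₃.γ₁) (vg₂ := g.q₃.γ₁ + g.q₃.γ₁) (v₁ := g.F₃) (v₂ := g.F₃ + g.q₃.ℓy)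
    (v₃ := g.G₃y) (Tin := 47) (zb := fun q' => yBit₄ g I (q / g.per₃y) q') (Sin := S₄)
    (by decide) (by decide) (by decide) (by decide) (by decide) (by decide) (by decide)
    (by decide) (by decide) (by decide) (by decide) (by decide) (by decide) (by decide) (by decide)
    (by decide) (by decide) (by decide) (by decide) (by decide) (by decide)
    (by rw [Function.update_self]) (hC₁ 50 (by decide)) (hC₁ 51 (by decide)) (hC₁ 52 (by decide))
    (hC₁ 56 (by decide)) (hC₁ 57 (by decide)) (by rw [h5₁]; exact hT) hW2
    (by have := Nat.mod_le q g.per₃y; omega) (by decide)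
    (fun hge hlt R' hK' h6' => by
      have hC' := hC₁.of_kept (S := [2, 6]) (by decide) hK'
      have h7' : R' 7 = q / g.per₃y := by
        rw [hK' 7 (by decide), Function.update_of_ne (by decide), Function.update_self]
      have h5' : R' 5 = T := by rw [hK' 5 (by decide), h5₁]
      have := innerY4_spec (O := O) g I hg hC' hIB h6' h7' h5' hqn hT hD hB
        (by have := Nat.mod_le q g.per₃y; omega)
      rwa [h5₁])
  rw [h5₁] at key
  refine key.mono (fun m hm => ?_) le_rfl
  obtain ⟨R', hm, hK'⟩ := hm
  exact ⟨R', hm, hK₁.trans hK'⟩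

/-- **The body of the `y` loop**: target `5 := Q + 1 + LX + p`, the three-way dispatch of the
padding of `y` around `innerY5`, then `3 += 1`, `4 -= 1`. [folklore] -/
def bodyY : SProg :=
  seqs [block [(.add, r 5, r 76, r 3)], threeWay 3 5 60 61 innerY5,
    block [(.add, r 3, r 3, im 1), (.sub, r 4, r 4, im 1)]]

/-- `bodyY` is query-free. [folklore] -/
theorem bodyY_queryFree : bodyY.QueryFree := by
  refine seqs_queryFree fun s hs => ?_
  simp only [List.mem_cons, List.not_mem_nil, or_false] at hs
  rcases hs with rfl | rfl | rfl
  · exact block_queryFree _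
  · refine threeWay_queryFree (seqs_queryFree fun s hs => ?_)
    simp only [List.mem_cons, List.not_mem_nil, or_false] at hs
    rcases hs with rfl | rfl
    · exact block_queryFree _
    · refine edWay_queryFree (threeWay_queryFree (edWay_queryFree (threeWay_queryFree ?_)))
      refine seqs_queryFree fun s hs => ?_
      simp only [List.mem_cons, List.not_mem_nil, or_false] at hs
      rcases hs with rfl | rfl
      · exact block_queryFree _
      · exact edWay_queryFree (block_queryFree _)
  · exact block_queryFree _

set_option maxHeartbeats 800000 in
/-- **Certificate of the body of the `y` loop**: from `3 = p < LY`, `4 = c` it writes the word of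
`yBit₆ p` at `Q + 1 + LX + p` and leaves `3 = p + 1`, `4 = c - 1`, all constants kept, within `66`
steps. [folklore] -/
theorem bodyY_spec {R H : ℕ → ℕ} (hg : g.n = I.n ∧ g.d = I.d) (hC : g.Consts R) (hn : 0 < I.n)
    (hIB : InputB g I H) {p c : ℕ} (h3 : R 3 = p) (h4 : R 4 = c) (hp : p < g.LY) (hc : 1 ≤ c)
    (hcW : c < 2 ^ W) (hD : 100 ≤ g.D) (hB : g.BND < 2 ^ W) :
    Achieves W O bodyY (merge R H)
      (fun m => ∃ R', m = merge R' (Function.update H (g.Q + 1 + g.LX + p) (yBit₆ g I p).toNat) ∧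
        g.Consts R' ∧ R' 3 = p + 1 ∧ R' 4 = c - 1) 66 := by
  have hBND : 10 * (g.D + g.LX + g.LY + g.LC + g.NP + g.Q) + 10000 ≤ g.BND := by unfold Geo.BND; omega
  have hW2 : 2 ≤ 2 ^ W := by omega
  have h76 : R 76 = g.Q + 1 + g.LX := hC 76 (by decide)
  have hLC : g.LC = g.n * g.G₃y + (g.n - 1) * g.q₃.γ₂ := rfl
  have hper : g.per₃y = g.G₃y + g.q₃.γ₂ := rfl
  unfold bodyY
  refine Achieves.seqs_cons (T₁ := 1) (T₂ := 65)
    (R := fun m => m = merge (Function.update R 5 (g.Q + 1 + g.LX + p)) H)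
    (achieves_block_of_eq' (fun m' hm' => ?_) (by decide)) fun m hm => ?_
  · simp (disch := first | omega | decide) only [execOps_cons, execOps_nil, execOp, Operand.write,
      Operand.read, merge_apply_of_lt, update_merge_of_lt, BinOp.eval_add_of_lt, h3, h76] at hm'
    exact hm'
  subst hm
  set R₁ := Function.update R 5 (g.Q + 1 + g.LX + p) with hR₁
  have hK₁ : Kept [5] R R₁ := Kept.rfl.update (by simp) _
  have hC₁ := hC.of_kept (S := [5]) (by decide) hK₁
  have h5₁ : R₁ 5 = g.Q + 1 + g.LX + p := by rw [hR₁, Function.update_self]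
  have h3₁ : R₁ 3 = p := by rw [hR₁, Function.update_of_ne (by decide), h3]
  refine Achieves.seqs_cons (T₁ := 63) (T₂ := 2)
    (R := Post (2 :: 6 :: S₅) R₁ (Function.update H (g.Q + 1 + g.LX + p) (yBit₆ g I p).toNat)) ?_
    fun m hm => ?_
  · have key := threeWay_spec (W := W) (O := O) (rp := 3) (tgt := 5) (c₁ := 60) (c₂ := 61)
      (inner := innerY5) (R := R₁) (H := H) (pv := p) (v₁ := g.NP) (v₂ := g.NP + g.LC) (Tin := 56)
      (cb := fun q => yBit₅ g I q) (Sin := S₅)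
      (by decide) (by decide) (by decide) (by decide) (by decide) (by decide) (by decide) (by decide)
      (by decide) h3₁ (hC₁ 60 (by decide)) (hC₁ 61 (by decide)) (by rw [h5₁]; unfold Geo.Q; omega) hW2
      (by omega) (by decide)
      (fun hge hlt R' hK' h6' => by
        have hC' := hC₁.of_kept (S := [2, 6]) (by decide) hK'
        have h5' : R' 5 = g.Q + 1 + g.LX + p := by rw [hK' 5 (by decide), h5₁]
        have hqn : (p - g.NP) / g.per₃y < I.n := by
          rw [← hg.1]
          have hn' : 1 ≤ g.n := by rw [hg.1]; exact hn
          refine (Nat.div_lt_iff_lt_mul ?_).2 ?_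
          · by_contra h0
            have h0' : g.per₃y = 0 := by omega
            have : g.LC = 0 := by
              rw [hLC]
              have : g.G₃y = 0 := by omega
              have : g.q₃.γ₂ = 0 := by omega
              simp [*]
            omega
          · have h1 : g.n * g.per₃y = g.n * g.G₃y + (g.n - 1) * g.q₃.γ₂ + g.q₃.γ₂ := by
              obtain ⟨k, hk⟩ : ∃ k, g.n = k + 1 := ⟨g.n - 1, by omega⟩
              rw [hk, Nat.add_sub_cancel, hper]; ring
            rw [h1, ← hLC]; omega
        have := innerY5_spec (O := O) g I hg hC' hIB h6' h5' hqn (by unfold Geo.Q; omega) hD hB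
          (by omega)
        rwa [h5₁])
    rw [h5₁] at key
    exact key
  · obtain ⟨R₂, hm, hK₂⟩ := hm
    subst hm
    have hC₂ := hC₁.of_kept (S := 2 :: 6 :: S₅) (by decide) hK₂
    have h3₂ : R₂ 3 = p := by rw [hK₂ 3 (by decide), h3₁]
    have h4₂ : R₂ 4 = c := by rw [hK₂ 4 (by decide), hR₁, Function.update_of_ne (by decide), h4]
    refine Achieves.seqs_cons (T₁ := 2) (T₂ := 0) (achieves_block_of_eq' (fun m' hm' => ?_) (by decide))
      fun m hm => Achieves.seqs_nil hm
    simp (disch := first | omega | decide) only [execOps_cons, execOps_nil, execOp, Operand.write,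
      Operand.read, merge_apply_of_lt, update_merge_of_lt, Function.update_of_ne, BinOp.eval_add_of_lt,
      BinOp.eval_sub_of_le, h3₂, h4₂] at hm'
    subst hm'
    refine ⟨_, rfl, hC₂.of_kept (S := [3, 4]) (by decide)
      ((Kept.rfl.update (by simp) _).update (by simp) _), ?_, ?_⟩
    · rw [Function.update_of_ne (by decide), Function.update_self]
    · rw [Function.update_self]

end yloop

/-! ### The `y` loop -/

section yloop2

variable {W : ℕ} {O : List ℕ → List ℕ} (g : Geo) (I : OVInstance)

/-- The initialisation and the `y` loop: `3 := 0`, `4 := LY`, then `LY` iterations of `bodyY`.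
[folklore] -/
def loopY : SProg := seq (block [(.add, r 3, im 0, im 0), (.add, r 4, r 71, im 0)]) (whilenz (r 4) bodyY)

/-- `loopY` is query-free. [folklore] -/
theorem loopY_queryFree : loopY.QueryFree := ⟨block_queryFree _, bodyY_queryFree⟩

/-- The data memory after `i` iterations of the `y` loop: the words of `yBit₆ p`, `p < i`, at
`Q + 1 + LX + p`. [folklore] -/
def yData (H₀ : ℕ → ℕ) (i : ℕ) : ℕ → ℕ := fun a =>
  if g.Q + 1 + g.LX ≤ a ∧ a < g.Q + 1 + g.LX + i then (yBit₆ g I (a - (g.Q + 1 + g.LX))).toNat else H₀ a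

/-- Before the `y` loop the data are untouched. [folklore] -/
theorem yData_zero (H₀ : ℕ → ℕ) : yData g I H₀ 0 = H₀ := by
  funext a; unfold yData; rw [if_neg (by omega)]

/-- One more iteration of the `y` loop in the data. [folklore] -/
theorem yData_succ (H₀ : ℕ → ℕ) (i : ℕ) :
    Function.update (yData g I H₀ i) (g.Q + 1 + g.LX + i) (yBit₆ g I i).toNat = yData g I H₀ (i + 1) := by
  funext a
  unfold yData
  by_cases ha : a = g.Q + 1 + g.LX + i
  · subst ha; rw [Function.update_self, if_pos ⟨by omega, by omega⟩]; congr 2; omega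
  · rw [Function.update_of_ne ha]
    by_cases h1 : g.Q + 1 + g.LX ≤ a ∧ a < g.Q + 1 + g.LX + i
    · rw [if_pos h1, if_pos ⟨h1.1, by omega⟩]
    · rw [if_neg h1, if_neg (by omega)]

/-- The input bits of `B` sit below the query base, so the `y` loop does not disturb them. [folklore] -/
theorem inputB_yData {H₀ : ℕ → ℕ} (hIB : InputB g I H₀) (hg : g.n = I.n ∧ g.d = I.d)
    (hL : 2 + 2 * (g.n * g.d) ≤ g.L) (i : ℕ) : InputB g I (yData g I H₀ i) := by
  intro j k
  have h1 : (j : ℕ) * I.d + I.d ≤ I.n * I.d := by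
    have := Nat.mul_le_mul_right I.d j.isLt; rw [Nat.succ_mul] at this; exact this
  have h2 : I.n * I.d = g.n * g.d := by rw [hg.1, hg.2]
  have hk := k.isLt
  unfold yData
  rw [if_neg (by unfold Geo.Q; omega)]
  exact hIB j k

/-- **Certificate of the `y` loop.** [folklore] -/
theorem loopY_spec {R H : ℕ → ℕ} (hg : g.n = I.n ∧ g.d = I.d) (hC : g.Consts R) (hn : 0 < I.n)
    (hIB : InputB g I H) (hL : 2 + 2 * (g.n * g.d) ≤ g.L) (hD : 100 ≤ g.D) (hB : g.BND < 2 ^ W) :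
    Achieves W O loopY (merge R H)
      (fun m => ∃ R', m = merge R' (yData g I H g.LY) ∧ g.Consts R' ∧ R' 3 = g.LY ∧ R' 4 = 0)
      (2 + (g.LY * 68 + 1)) := by
  have hLY : g.LY < 2 ^ W := by unfold Geo.BND at hB; omega
  have h71 : R 71 = g.LY := hC 71 (by decide)
  unfold loopY
  refine Achieves.seq (T₁ := 2) (T₂ := g.LY * 68 + 1)
    (R := fun m => m = merge (Function.update (Function.update R 3 0) 4 g.LY) H)
    (achieves_block_of_eq' (fun m' hm' => ?_) (by decide)) fun m hm => ?_
  · simp (disch := first | omega | decide) only [execOps_cons, execOps_nil, execOp, Operand.write,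
      Operand.read, merge_apply_of_lt, update_merge_of_lt, Function.update_of_ne, BinOp.eval_add_of_lt,
      Nat.add_zero, h71] at hm'
    exact hm'
  subst hm
  have hK₀ : Kept [3, 4] R (Function.update (Function.update R 3 0) 4 g.LY) :=
    (Kept.rfl.update (by simp) _).update (by simp) _
  have hC₀ := hC.of_kept (S := [3, 4]) (by decide) hK₀
  refine Achieves.whilenz g.LY 66
    (fun i m => ∃ R', m = merge R' (yData g I H i) ∧ g.Consts R' ∧ R' 3 = i ∧ R' 4 = g.LY - i)
    (fun i hi m ⟨R', hm, hC', h3', h4'⟩ => ⟨?_, ?_⟩) (fun m ⟨R', hm, _, _, h4'⟩ => ?_)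
    ⟨_, by rw [yData_zero], hC₀, by rw [Function.update_of_ne (by decide), Function.update_self],
      by rw [Function.update_self]; omega⟩
    (fun m ⟨R', hm, hC', h3', h4'⟩ => ⟨R', hm, hC', h3', h4'.trans (Nat.sub_self _)⟩) le_rfl
  · subst hm; simp only [Operand.read, merge_apply_of_lt (show (4 : ℕ) < 100 by decide), h4']; omega
  · subst hm
    have := bodyY_spec (O := O) g I hg hC' hn (inputB_yData g I hIB hg hL i) h3' h4' hi (by omega)
      (by omega) hD hB
    refine this.mono (fun m ⟨R'', hm, hC'', h3'', h4''⟩ => ⟨R'', ?_, hC'', h3'', by omega⟩) le_rfl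
    rw [hm, yData_succ]
  · subst hm; simp only [Operand.read, merge_apply_of_lt (show (4 : ℕ) < 100 by decide), h4', Nat.sub_self]

end yloop2

end Literature.Computability.FineGrained.EDRed
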